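import Mathlib.NumberTheory.ModularForms.Bounds
import Mathlib.Analysis.Fourier.AddCircle
import Mathlib.Analysis.SpecialFunctions.Complex.LogBounds
import Mathlib.Analysis.Complex.ExponentialBounds
import Mathlib.FieldTheory.IsAlgClosed.Basic
import Mathlib.Analysis.Complex.Polynomial.Basic
import Mathlib.NumberTheory.EulerProduct.Basic
import Literature.NumberTheory.EllipticCurves.DeligneSerreRankin
import Literature.NumberTheory.EllipticCurves.HeckeOperatorsGamma1QExpansionProofs
import HarnessLib

/-!
# Deligne–Serre 1974, Prop. 5.1 (Rankin's estimate): discharge of `prop51`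

This file PROVES the named fact `Literature.NumberTheory.EllipticCurves.ModularForms.DeligneSerre1974.prop51`
(`Literature.NumberTheory.EllipticCurves.DeligneSerreRankin`; Deligne–Serre, *Formes modulaires
de poids 1*, Prop. 5.1): for a non-zero cusp form `f` of type `(k, ε)` on `Γ₀(N)` which is an
eigenfunction of the `T_p`, `p ∤ N`, with eigenvalues `a_p`, the series `∑_{p ∤ N} |a_p|² p^{-s}`
converges for real `s > k`, and `∑_{p ∤ N} |a_p|² p^{-s} ≤ log (1/(s-k)) + O(1)` as `s → k⁺`
(5.1.1), as `theorem prop51_holds : prop51`. Users holding `(h : prop51)` (e.g.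
`DeligneSerreWeightOneIrreducible`, `DeligneSerreRankinProofs.prop55_of`,
`DeligneSerreWeightOneAssembly`) are fed `prop51_holds`.

## The proof

The printed proof (op. cit. 5.2) reduces to a newform, forms the four-factor Euler product
`L(s) = ∏_p det(1 - φ_p ⊗ φ̄_p p^{-s})^{-1} = H(s) ζ(2s-2k+2) ∑ |a_n|² n^{-s}`, invokes Rankin's
result (the meromorphic continuation of `∑ |a_n|² n^{-s}` with a simple pole at `s = k`) and
Landau's lemma to get `g(s) = log L(s) = log(1/(s-k)) + O(1)`, and concludes by the positivity
`g₁(s) = ∑ |a_p|² p^{-s} ≤ g(s)`. Mathlib has neither Rankin–Selberg nor newform theory; the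
proof below keeps the architecture but replaces the two deep inputs by elementary substitutes
which suffice for the *inequality* (5.1.1):

* **A (analytic input).** Instead of Rankin's continuation, the majorant
  `∑_n |a_n|² n^{-s} = O(1/(s-k))` (`s → k⁺`): Parseval's formula on the horizontal line
  `im τ = t` (Mathlib's `hasSum_sq_fourierCoeffOn`) and the bound `|f(τ)| ≤ C (im τ)^{-k/2}`
  (Mathlib's `CuspFormClass.exists_bound`) give `∑_n |a_n|² e^{-4πnt} ≤ C t^{-k}`
  (`sum_sq_coeff_exp_le`), and a dyadic decomposition turns this into
  `∑_n |a_n|² n^{-s} ≤ C' 2^s/(1 - 2^{k-s})` (`sum_sq_coeff_rpow_le`).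
* **B (reduction).** Instead of passing to a newform, fix `n₀` with `a_{n₀} ≠ 0`; the
  `T_p`-recursion on `q`-expansions (the tree's `qExpansion_coeff_heckeT_gamma1_holds`,
  Diamond–Shurman Prop. 5.2.2) gives `a_{m n₀} = Λ(m) a_{n₀}` for `m` prime to `n₀ N`, where
  `Λ` is the multiplicative function with `Λ(p^r) = x_p(r)`, `x_p` the solution of
  `x_{r+2} = a_p x_{r+1} - ε(p)p^{k-1} x_r` (`coeff_mul_eq_eulerCoeff`). Hence the multiplicative
  weight `g_s(m) = |Λ(m)|² m^{-s}` has `∑_m g_s(m) ≤ (n₀^s/|a_{n₀}|²) ∑ |a_n|² n^{-s}`.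
* **C (one Euler factor, op. cit. 5.2).** For the tensor square one has the identity
  `(∑_r x_r x̄_r T^r) · ∏ᵢⱼ(1 - λᵢλ̄ⱼT) = 1 - |ε(p)p^{k-1}|² T²` (`tsum_recSeq_mul_recSeq`, from the
  fourth-order recurrence of products) and `-log ∏ᵢⱼ(1 - λᵢλ̄ⱼT) = ∑_m |λ₁ᵐ + λ₂ᵐ|² Tᵐ/m ≥ |a_p|² T`
  (`quartic_le_exp`), whence `|a_p|² p^{-s} ≤ log ∑_r g_s(p^r) - log(1 - p^{2(k-1-s)})`
  (`local_estimate`, `local_step`); the necessary bound `|λᵢ|² < p^s` on the roots comes from the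
  convergence at some `s' ∈ (k, s)` (`norm_root_le`).
* **D (assembly).** Multiplying over a finite set of good primes (Mathlib's
  `EulerProduct.prod_filter_prime_tsum_eq_tsum_factoredNumbers`) and using A–C:
  `∑_{p ∈ S} |a_p|² p^{-s} ≤ log(A/(s-k)) + (4/3) ∑ n^{-2} + ∑_{p ∣ n₀} |a_p|²` for `s ∈ (k, k+1]`.

Cusp forms of weight `k < 0` are shown to vanish from the Parseval bound
(`eq_zero_of_weight_neg`), so that `s > k ≥ 0` throughout.

## References

* P. Deligne, J.-P. Serre, *Formes modulaires de poids 1*, Ann. Sci. ÉNS (4) 7 (1974), 507–530,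
  Prop. 5.1 and no. 5.2 (pp. 518–519), (1.7.2).
* R. A. Rankin, *Contributions to the theory of Ramanujan's function τ(n) and similar
  arithmetical functions II*, Proc. Cambridge Philos. Soc. 35 (1939), 357–372.
* F. Diamond, J. Shurman, *A first course in modular forms*, GTM 228, Springer 2005,
  Prop. 5.2.2 (the `T_p`-recursion) and §5.9 (Hecke's bound).
-/


noncomputable section

open scoped MatrixGroups Topology Real ComplexConjugate

open CongruenceSubgroup Filter Complex MeasureTheory
open UpperHalfPlane hiding I
open Literature.NumberTheory.EllipticCurves.ModularForms.HeckeTGamma1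

namespace Literature.NumberTheory.EllipticCurves.ModularForms.DeligneSerre1974.Prop51

/-! ## A. The analytic input: Parseval and the dyadic bound -/


variable {N : ℕ} [NeZero N] {k : ℤ}

/-- Exponential bookkeeping on the horizontal line `im τ = t`:
`e^{-2πnt} · q(u + it)^{-n} = e^{2πi(-n)u}` for `q(z) = e^{2πiz}`. [folklore] -/
lemma exp_line_identity (u t : ℝ) (n : ℕ) :
    (Real.exp (-2 * π * n * t) : ℂ) * (Function.Periodic.qParam 1 (u + t * Complex.I) ^ n)⁻¹ =
      Complex.exp (2 * π * Complex.I * -(n : ℂ) * u) := by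
  rw [Function.Periodic.qParam, ← Complex.exp_nat_mul, ← Complex.exp_neg, Complex.ofReal_exp,
    ← Complex.exp_add]
  congr 1
  push_cast
  ring_nf
  rw [Complex.I_sq]
  ring

/-- For `t > 0`, the `n`-th Fourier coefficient on `[0, 1]` of `u ↦ f(u + it)` is
`e^{-2πnt} a_n(f)` (`f ∈ S_k(Γ₁(N))`, period-`1` `q`-expansion). [folklore] -/
theorem fourierCoeffOn_line (f : CuspForm (Gamma1 N) k) {t : ℝ} (ht : 0 < t) (n : ℕ) :
    fourierCoeffOn zero_lt_one (fun u : ℝ ↦ f ⟨(u : ℂ) + t * Complex.I, by simpa using ht⟩) n =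
      (Real.exp (-2 * π * n * t) : ℂ) * (qExpansion 1 ⇑f).coeff n := by
  rw [fourierCoeffOn_eq_integral, qExpansion_coeff_eq_intervalIntegral one_pos
    (SlashInvariantFormClass.periodic_comp_ofComplex f (one_mem_strictPeriods_Gamma1 N))
    (ModularFormClass.holo f) (ModularFormClass.bdd_at_infty f) n ht]
  simp only [fourier_coe_apply, smul_eq_mul, UpperHalfPlane.coe_I, sub_zero, ofReal_one, div_one,
    Int.cast_neg, Int.cast_natCast, one_div, one_smul, one_mul]
  rw [← intervalIntegral.integral_const_mul]
  refine intervalIntegral.integral_congr fun u _ ↦ ?_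
  rw [← mul_assoc, exp_line_identity u t n]

/-- **Parseval bound on horizontal lines.** For `f ∈ S_k(Γ₁(N))` there is `C > 0` with
`∑_{n ∈ F} |a_n(f)|² e^{-4πnt} ≤ C t^{-k}` for every `t > 0` and every finite set `F`
(Parseval on `[0, 1]` for `u ↦ f(u + it)` and `|f(τ)| ≤ C' (im τ)^{-k/2}`). [folklore] -/
theorem sum_sq_coeff_exp_le (f : CuspForm (Gamma1 N) k) :
    ∃ C : ℝ, 0 < C ∧ ∀ t : ℝ, 0 < t → ∀ F : Finset ℕ,
      ∑ n ∈ F, ‖(qExpansion 1 ⇑f).coeff n‖ ^ 2 * Real.exp (-4 * π * n * t) ≤ C * t ^ (-k) := by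
  obtain ⟨C, hC⟩ := CuspFormClass.exists_bound f
  refine ⟨C ^ 2 + 1, by positivity, fun t ht F ↦ ?_⟩
  set g : ℝ → ℂ := fun u ↦ f ⟨(u : ℂ) + t * Complex.I, by simpa using ht⟩ with hg
  have hgc : Continuous g := by
    rw [hg]
    fun_prop
  have hgb : ∀ u, ‖g u‖ ≤ C / t ^ ((k : ℝ) / 2) := fun u ↦ by
    have h := hC ⟨(u : ℂ) + t * Complex.I, by simpa using ht⟩
    have him : UpperHalfPlane.im ⟨(u : ℂ) + t * Complex.I, by simpa using ht⟩ = t := by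
      simp [UpperHalfPlane.im]
    rwa [him] at h
  have hL2 : MemLp g 2 (volume.restrict (Set.Ioc (0 : ℝ) 1)) :=
    MemLp.of_bound hgc.aestronglyMeasurable _ (ae_of_all _ hgb)
  have hP := hasSum_sq_fourierCoeffOn zero_lt_one hL2
  have hint : ∫ x in (0 : ℝ)..1, ‖g x‖ ^ 2 ≤ (C / t ^ ((k : ℝ) / 2)) ^ 2 := by
    have h := intervalIntegral.norm_integral_le_of_norm_le_const (a := (0 : ℝ)) (b := 1)
      (C := (C / t ^ ((k : ℝ) / 2)) ^ 2) (f := fun x ↦ ‖g x‖ ^ 2) (fun x _ ↦ by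
        rw [Real.norm_of_nonneg (by positivity)]
        exact pow_le_pow_left₀ (norm_nonneg _) (hgb x) 2)
    rw [sub_zero, abs_one, mul_one] at h
    exact (Real.le_norm_self _).trans h
  have hpow : (C / t ^ ((k : ℝ) / 2)) ^ 2 = C ^ 2 * t ^ (-k) := by
    rw [div_pow, ← Real.rpow_natCast (t ^ ((k : ℝ) / 2)) 2, ← Real.rpow_mul ht.le]
    rw [show (k : ℝ) / 2 * ((2 : ℕ) : ℝ) = (k : ℝ) by push_cast; ring, Real.rpow_intCast,
      zpow_neg, div_eq_mul_inv]
  calc ∑ n ∈ F, ‖(qExpansion 1 ⇑f).coeff n‖ ^ 2 * Real.exp (-4 * π * n * t)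
      = ∑ n ∈ F, ‖fourierCoeffOn zero_lt_one g n‖ ^ 2 := by
        refine Finset.sum_congr rfl fun n _ ↦ ?_
        rw [hg, fourierCoeffOn_line f ht n, norm_mul, mul_pow, Complex.norm_real,
          Real.norm_of_nonneg (Real.exp_pos _).le, ← Real.exp_nat_mul, mul_comm]
        congr 2
        push_cast
        ring
    _ = ∑ i ∈ F.map ⟨((↑) : ℕ → ℤ), Nat.cast_injective⟩,
          ‖fourierCoeffOn zero_lt_one g i‖ ^ 2 := by
        rw [Finset.sum_map]
        rfl
    _ ≤ ((1 : ℝ) - 0)⁻¹ • ∫ x in (0 : ℝ)..1, ‖g x‖ ^ 2 :=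
        sum_le_hasSum _ (fun i _ ↦ by positivity) hP
    _ ≤ (C / t ^ ((k : ℝ) / 2)) ^ 2 := by simpa using hint
    _ = C ^ 2 * t ^ (-k) := hpow
    _ ≤ (C ^ 2 + 1) * t ^ (-k) := by
        gcongr
        linarith


/-- Exponent bookkeeping for the dyadic decomposition: `2^{-is} (2^{-i})^{-k} = (2^{k-s})^i`.
[folklore] -/
lemma two_rpow_aux (i : ℕ) (s : ℝ) (k : ℤ) :
    (2 : ℝ) ^ (-((i : ℝ) * s)) * ((2 : ℝ) ^ (-(i : ℝ))) ^ (-k) = ((2 : ℝ) ^ ((k : ℝ) - s)) ^ i := by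
  rw [← Real.rpow_intCast _ (-k), ← Real.rpow_mul zero_le_two, ← Real.rpow_add two_pos,
    ← Real.rpow_mul_natCast zero_le_two]
  congr 1
  push_cast
  ring

/-- The dyadic comparison `n^{-s} ≤ 2^s 2^{-js} · e^{4π} e^{-4πn 2^{-j}}` for `j = ⌊log₂ n⌋ + 1`
(so that `2^{j-1} ≤ n < 2^j`) and `s ≥ 0`. [folklore] -/
lemma rpow_neg_le_dyadic {n : ℕ} (hn : 0 < n) {s : ℝ} (hs : 0 ≤ s) :
    (n : ℝ) ^ (-s) ≤ (2 : ℝ) ^ s * (2 : ℝ) ^ (-(((Nat.log 2 n + 1 : ℕ) : ℝ) * s)) *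
      (Real.exp (4 * π) * Real.exp (-4 * π * n * (2 : ℝ) ^ (-((Nat.log 2 n + 1 : ℕ) : ℝ)))) := by
  set j : ℕ := Nat.log 2 n + 1 with hj
  have h1 : (2 : ℝ) ^ j ≤ 2 * n := by
    have h := Nat.pow_log_le_self 2 hn.ne'
    have : (2 : ℕ) ^ j ≤ 2 * n := by rw [hj, pow_succ]; omega
    exact_mod_cast this
  have h2 : (n : ℝ) ≤ (2 : ℝ) ^ j := by
    exact_mod_cast (Nat.lt_pow_succ_log_self one_lt_two n).le
  have h2pos : (0 : ℝ) < (2 : ℝ) ^ j := by positivity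
  -- (a) `n^{-s} ≤ 2^s 2^{-js}`
  have ha : (n : ℝ) ^ (-s) ≤ (2 : ℝ) ^ s * (2 : ℝ) ^ (-((j : ℝ) * s)) := by
    have h3 : ((2 : ℝ) * n) ^ (-s) ≤ ((2 : ℝ) ^ j) ^ (-s) :=
      Real.rpow_le_rpow_of_nonpos h2pos h1 (by linarith)
    rw [Real.mul_rpow zero_le_two (Nat.cast_nonneg n)] at h3
    have h4 : ((2 : ℝ) ^ j) ^ (-s) = (2 : ℝ) ^ (-((j : ℝ) * s)) := by
      rw [← Real.rpow_natCast, ← Real.rpow_mul zero_le_two]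
      ring_nf
    have h5 : (2 : ℝ) ^ s * (2 : ℝ) ^ (-s) = 1 := by
      rw [← Real.rpow_add two_pos]; simp
    calc (n : ℝ) ^ (-s) = (2 : ℝ) ^ s * ((2 : ℝ) ^ (-s) * (n : ℝ) ^ (-s)) := by
          rw [← mul_assoc, h5, one_mul]
      _ ≤ (2 : ℝ) ^ s * ((2 : ℝ) ^ j) ^ (-s) := by gcongr
      _ = _ := by rw [h4]
  -- (b) `1 ≤ e^{4π} e^{-4π n 2^{-j}}`
  have hb : (1 : ℝ) ≤ Real.exp (4 * π) * Real.exp (-4 * π * n * (2 : ℝ) ^ (-(j : ℝ))) := by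
    rw [← Real.exp_add]
    apply Real.one_le_exp
    have h6 : (n : ℝ) * (2 : ℝ) ^ (-(j : ℝ)) ≤ 1 := by
      rw [Real.rpow_neg zero_le_two, Real.rpow_natCast, ← div_eq_mul_inv, div_le_one h2pos]
      exact h2
    nlinarith [Real.pi_pos, h6]
  calc (n : ℝ) ^ (-s) ≤ (2 : ℝ) ^ s * (2 : ℝ) ^ (-((j : ℝ) * s)) * 1 := by rw [mul_one]; exact ha
    _ ≤ _ := by gcongr

/-- **Dyadic (discrete Mellin) bound.** For `f ∈ S_k(Γ₁(N))` there is `C > 0` such that for all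
real `s > max(k, 0)` and all finite `F ⊆ ℕ`,
`∑_{n ∈ F} |a_n(f)|² n^{-s} ≤ C 2^s / (1 - 2^{k-s})`; in particular `∑ |a_n|² n^{-s}` converges
for `s > k` and is `O(1/(s-k))` as `s → k⁺` (the classical consequence of Rankin's theorem that
is needed below, obtained here from the Parseval bound). [folklore] -/
theorem sum_sq_coeff_rpow_le (f : CuspForm (Gamma1 N) k) :
    ∃ C : ℝ, 0 < C ∧ ∀ s : ℝ, 0 < s → (k : ℝ) < s → ∀ F : Finset ℕ,
      ∑ n ∈ F, ‖(qExpansion 1 ⇑f).coeff n‖ ^ 2 * (n : ℝ) ^ (-s) ≤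
        C * (2 : ℝ) ^ s / (1 - (2 : ℝ) ^ ((k : ℝ) - s)) := by
  obtain ⟨C₀, hC₀, hA⟩ := sum_sq_coeff_exp_le f
  refine ⟨Real.exp (4 * π) * C₀, by positivity, fun s hs hks F ↦ ?_⟩
  set b : ℕ → ℝ := fun n ↦ ‖(qExpansion 1 ⇑f).coeff n‖ ^ 2 with hb
  have hA' : ∀ t : ℝ, 0 < t → ∀ F : Finset ℕ,
      ∑ n ∈ F, b n * Real.exp (-4 * π * n * t) ≤ C₀ * t ^ (-k) := hA
  have hb0 : ∀ n, 0 ≤ b n := fun n ↦ by positivity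
  set q : ℝ := (2 : ℝ) ^ ((k : ℝ) - s) with hq
  have hq0 : 0 < q := Real.rpow_pos_of_pos two_pos _
  have hq1 : q < 1 := Real.rpow_lt_one_of_one_lt_of_neg one_lt_two (by linarith)
  let j : ℕ → ℕ := fun n ↦ Nat.log 2 n + 1
  set J : ℕ := F.sup j + 1 with hJ
  have hjJ : ∀ n ∈ F, j n < J := fun n hn ↦ Nat.lt_succ_of_le (Finset.le_sup hn)
  have key : ∀ n ∈ F, b n * (n : ℝ) ^ (-s) ≤
      (2 : ℝ) ^ s * Real.exp (4 * π) * ∑ i ∈ Finset.range J,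
        (2 : ℝ) ^ (-((i : ℝ) * s)) * (b n * Real.exp (-4 * π * n * (2 : ℝ) ^ (-(i : ℝ)))) := by
    intro n hn
    rcases Nat.eq_zero_or_pos n with rfl | hn0
    · rw [Nat.cast_zero, Real.zero_rpow (neg_ne_zero.mpr hs.ne'), mul_zero]
      exact mul_nonneg (by positivity) (Finset.sum_nonneg fun i _ ↦ by positivity)
    · have hterm : b n * (n : ℝ) ^ (-s) ≤ (2 : ℝ) ^ s * Real.exp (4 * π) *
          ((2 : ℝ) ^ (-((j n : ℝ) * s)) * (b n * Real.exp (-4 * π * n * (2 : ℝ) ^ (-(j n : ℝ))))) :=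
        calc b n * (n : ℝ) ^ (-s) ≤ b n * ((2 : ℝ) ^ s * (2 : ℝ) ^ (-(((j n : ℕ) : ℝ) * s)) *
              (Real.exp (4 * π) * Real.exp (-4 * π * n * (2 : ℝ) ^ (-((j n : ℕ) : ℝ))))) :=
              mul_le_mul_of_nonneg_left (rpow_neg_le_dyadic hn0 hs.le) (hb0 n)
          _ = _ := by ring
      refine hterm.trans ?_
      gcongr
      refine Finset.single_le_sum (f := fun i : ℕ ↦ (2 : ℝ) ^ (-((i : ℝ) * s)) *
        (b n * Real.exp (-4 * π * n * (2 : ℝ) ^ (-(i : ℝ))))) (fun i _ ↦ ?_)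
        (Finset.mem_range.mpr (hjJ n hn))
      exact mul_nonneg (by positivity) (mul_nonneg (hb0 n) (by positivity))
  have hgeom : ∑ i ∈ Finset.range J, q ^ i ≤ (1 - q)⁻¹ := by
    rw [geom_sum_eq hq1.ne, div_eq_mul_inv]
    have : (q ^ J - 1) * (q - 1)⁻¹ = (1 - q ^ J) * (1 - q)⁻¹ := by
      rw [← neg_sub 1 (q ^ J), ← neg_sub 1 q, inv_neg, neg_mul_neg]
    rw [this]
    apply mul_le_of_le_one_left (inv_nonneg.mpr (by linarith))
    linarith [pow_nonneg hq0.le J]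
  calc ∑ n ∈ F, b n * (n : ℝ) ^ (-s)
      ≤ ∑ n ∈ F, (2 : ℝ) ^ s * Real.exp (4 * π) * ∑ i ∈ Finset.range J,
          (2 : ℝ) ^ (-((i : ℝ) * s)) * (b n * Real.exp (-4 * π * n * (2 : ℝ) ^ (-(i : ℝ)))) :=
        Finset.sum_le_sum key
    _ = (2 : ℝ) ^ s * Real.exp (4 * π) * ∑ i ∈ Finset.range J,
          (2 : ℝ) ^ (-((i : ℝ) * s)) * ∑ n ∈ F, b n * Real.exp (-4 * π * n * (2 : ℝ) ^ (-(i : ℝ))) := by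
        rw [← Finset.mul_sum, Finset.sum_comm]
        simp only [Finset.mul_sum]
    _ ≤ (2 : ℝ) ^ s * Real.exp (4 * π) * ∑ i ∈ Finset.range J,
          (2 : ℝ) ^ (-((i : ℝ) * s)) * (C₀ * ((2 : ℝ) ^ (-(i : ℝ))) ^ (-k)) := by
        gcongr with i hi
        exact hA' _ (Real.rpow_pos_of_pos two_pos _) F
    _ = (2 : ℝ) ^ s * Real.exp (4 * π) * ∑ i ∈ Finset.range J, C₀ * q ^ i := by
        congr 1
        refine Finset.sum_congr rfl fun i _ ↦ ?_
        rw [hq, ← two_rpow_aux i s k]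
        ring
    _ = (2 : ℝ) ^ s * Real.exp (4 * π) * C₀ * ∑ i ∈ Finset.range J, q ^ i := by
        rw [← Finset.mul_sum]
        ring
    _ ≤ (2 : ℝ) ^ s * Real.exp (4 * π) * C₀ * (1 - q)⁻¹ := by gcongr
    _ = Real.exp (4 * π) * C₀ * (2 : ℝ) ^ s / (1 - (2 : ℝ) ^ ((k : ℝ) - s)) := by
        rw [hq, div_eq_mul_inv]
        ring

/-! ### The Hecke recursion at a prime -/

/-- The linear recurrence `x_0 = 1`, `x_1 = a`, `x_{n+2} = a x_{n+1} - b x_n`; for `a = a_p`,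
`b = ε(p) p^{k-1}` these are the `T_{p^n}`-eigenvalues of an eigenform, i.e. `x_n = ∑_{i+j=n} αⁱβʲ`
for the roots `α, β` of `X² - a_p X + ε(p) p^{k-1}` (Deligne–Serre (1.7.2): the Euler factor
`(1 - a_p p^{-s} + ε(p) p^{k-1-2s})^{-1}`). [cite: DeligneSerreASENS1974, (1.7.2)] -/
def recSeq {R : Type*} [CommRing R] (a b : R) : ℕ → R
  | 0 => 1
  | 1 => a
  | (n + 2) => a * recSeq a b (n + 1) - b * recSeq a b n

section recSeq

variable {R : Type*} [CommRing R] (a b : R)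

/-- `x_0 = 1`. [folklore] -/
@[simp] lemma recSeq_zero : recSeq a b 0 = 1 := rfl

/-- `x_1 = a`. [folklore] -/
@[simp] lemma recSeq_one : recSeq a b 1 = a := rfl

/-- `x_{n+2} = a x_{n+1} - b x_n`. [folklore] -/
lemma recSeq_add_two (n : ℕ) : recSeq a b (n + 2) = a * recSeq a b (n + 1) - b * recSeq a b n :=
  rfl

/-- `recSeq` commutes with ring homomorphisms. [folklore] -/
lemma map_recSeq {S : Type*} [CommRing S] (φ : R →+* S) :
    ∀ n, φ (recSeq a b n) = recSeq (φ a) (φ b) n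
  | 0 => by simp
  | 1 => by simp
  | (n + 2) => by
    rw [recSeq_add_two, recSeq_add_two, map_sub, map_mul, map_mul, map_recSeq φ (n + 1),
      map_recSeq φ n]

/-- In terms of the roots: if `a = α + β`, `b = α β` then `x_{n+1} - β x_n = α^{n+1}`. [folklore] -/
lemma recSeq_succ_sub_mul (α β : R) :
    ∀ n, recSeq (α + β) (α * β) (n + 1) - β * recSeq (α + β) (α * β) n = α ^ (n + 1)
  | 0 => by simp
  | (n + 1) => by
    have ih := recSeq_succ_sub_mul α β n
    rw [recSeq_add_two]
    linear_combination α * ih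

/-- `recSeq` is symmetric in the roots. [folklore] -/
lemma recSeq_comm_roots (α β : R) (n : ℕ) :
    recSeq (α + β) (α * β) n = recSeq (β + α) (β * α) n := by
  rw [add_comm, mul_comm]

/-- **The tensor-square recursion.** The products `z_n = x_n x'_n` of two solutions of
second-order recurrences (`a, b` and `a', b'`) satisfy the fourth-order recurrence whose
characteristic roots are the products `λᵢ μⱼ` of the characteristic roots. [folklore] -/
lemma recSeq_mul_recSeq_rec (a' b' : R) (n : ℕ) :
    recSeq a b (n + 4) * recSeq a' b' (n + 4) =
      a * a' * (recSeq a b (n + 3) * recSeq a' b' (n + 3))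
        - (a ^ 2 * b' + a' ^ 2 * b - 2 * b * b') * (recSeq a b (n + 2) * recSeq a' b' (n + 2))
        + a * a' * b * b' * (recSeq a b (n + 1) * recSeq a' b' (n + 1))
        - b ^ 2 * b' ^ 2 * (recSeq a b n * recSeq a' b' n) := by
  simp only [recSeq_add_two]
  ring

end recSeq

/-! ### Coefficients of a `T_p`-eigenform of type `(k, ε)` -/

/-- **The `T_p`-recursion on `q`-expansion coefficients** (Diamond–Shurman Prop. 5.2.2 /
Deligne–Serre (1.7.2)): if `f ∈ S_k(N, ε)` and `T_p f = c f` for a prime `p ∤ N`, then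
`c a_n = a_{pn} + 𝟙_{p ∣ n} ε(p) p^{k-1} a_{n/p}`. [cite: DiamondShurman2005, Prop. 5.2.2] -/
theorem coeff_recursion (ε : DirichletCharacter ℂ N) (f : CuspForm (Gamma1 N) k)
    (hf : f ∈ nebentypusSubspace N k ε) {p : ℕ} (hp : p.Prime) (hpN : ¬ p ∣ N) {c : ℂ}
    (heig : (haveI : NeZero p := ⟨hp.ne_zero⟩; heckeT (Gamma1 N) k p f) = c • f) (n : ℕ) :
    c * (qExpansion 1 ⇑f).coeff n = (qExpansion 1 ⇑f).coeff (p * n) +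
      if p ∣ n then ε p * (p : ℂ) ^ (k - 1) * (qExpansion 1 ⇑f).coeff (n / p) else 0 := by
  haveI : NeZero p := ⟨hp.ne_zero⟩
  have h := qExpansion_coeff_heckeT_gamma1_holds N k f p hp n
  have hdia : diamondOp N k (p : ZMod N) f = ε (p : ZMod N) • f := by
    have hcop : Nat.Coprime p N := (Nat.Prime.coprime_iff_not_dvd hp).mpr hpN
    have h1 := (Submodule.mem_iInf _).mp hf (ZMod.unitOfCoprime p hcop)
    rw [LinearMap.mem_ker, LinearMap.sub_apply, LinearMap.smul_apply, LinearMap.id_apply,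
      sub_eq_zero, ZMod.coe_unitOfCoprime] at h1
    exact h1
  rw [heig, hdia] at h
  simp only [CuspForm.IsGLPos.coe_smul, ModularForm.qExpansion_smul one_pos (one_mem_strictPeriods_Gamma1 N),
    map_smul, smul_eq_mul, hpN, if_false] at h
  rw [h]
  split_ifs <;> ring

/-- **Coefficients at `p^r m`, `p ∤ m`:** `a_{p^r m} = x_r a_m` with `x_r = recSeq a_p (ε(p)p^{k-1}) r`
(iterate the `T_p`-recursion). [cite: DiamondShurman2005, Prop. 5.2.2] -/
theorem coeff_prime_pow_mul (ε : DirichletCharacter ℂ N) (f : CuspForm (Gamma1 N) k)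
    (hf : f ∈ nebentypusSubspace N k ε) {p : ℕ} (hp : p.Prime) (hpN : ¬ p ∣ N) {c : ℂ}
    (heig : (haveI : NeZero p := ⟨hp.ne_zero⟩; heckeT (Gamma1 N) k p f) = c • f) {m : ℕ}
    (hpm : ¬ p ∣ m) :
    ∀ r : ℕ, (qExpansion 1 ⇑f).coeff (p ^ r * m) =
      recSeq c (ε p * (p : ℂ) ^ (k - 1)) r * (qExpansion 1 ⇑f).coeff m
  | 0 => by simp
  | 1 => by
    have h := coeff_recursion ε f hf hp hpN heig m
    rw [if_neg hpm, add_zero] at h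
    rw [pow_one, recSeq_one, h]
  | (r + 2) => by
    have h := coeff_recursion ε f hf hp hpN heig (p ^ (r + 1) * m)
    have hdvd : p ∣ p ^ (r + 1) * m := Dvd.dvd.mul_right (dvd_pow_self p r.succ_ne_zero) m
    have hdiv : p ^ (r + 1) * m / p = p ^ r * m := by
      rw [pow_succ', mul_assoc, Nat.mul_div_cancel_left _ hp.pos]
    rw [if_pos hdvd, hdiv, coeff_prime_pow_mul ε f hf hp hpN heig hpm (r + 1),
      coeff_prime_pow_mul ε f hf hp hpN heig hpm r, ← mul_assoc p, ← pow_succ'] at h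
    rw [recSeq_add_two, eq_sub_of_add_eq h.symm]
    ring

/-! ### The multiplicative function `Λ` -/

/-- `Λ_x(m) = ∏_{p^r ∥ m} x_p(r)` for a family of sequences `x_p` (with `Λ_x(0) = 1` by
convention, `0` having empty factorisation). For `x_p = recSeq a_p (ε(p) p^{k-1})` and `m`
prime to the level these are the `T_m`-eigenvalues (Deligne–Serre (1.7.2)). [folklore] -/
def eulerCoeff (x : ℕ → ℕ → ℂ) (m : ℕ) : ℂ :=
  m.factorization.prod fun p r ↦ x p r

/-- `Λ(0) = 1` (junk value). [folklore] -/
lemma eulerCoeff_zero (x : ℕ → ℕ → ℂ) : eulerCoeff x 0 = 1 := by simp [eulerCoeff]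

/-- `Λ(1) = 1`. [folklore] -/
lemma eulerCoeff_one (x : ℕ → ℕ → ℂ) : eulerCoeff x 1 = 1 := by simp [eulerCoeff]

/-- `Λ(p^r) = x_p(r)` (when `x_p(0) = 1`). [folklore] -/
lemma eulerCoeff_prime_pow (x : ℕ → ℕ → ℂ) (hx : ∀ p, x p 0 = 1) {p : ℕ} (hp : p.Prime)
    (r : ℕ) : eulerCoeff x (p ^ r) = x p r := by
  rw [eulerCoeff, hp.factorization_pow, Finsupp.prod_single_index (hx p)]

/-- `Λ(p) = x_p(1)`. [folklore] -/
lemma eulerCoeff_prime (x : ℕ → ℕ → ℂ) (hx : ∀ p, x p 0 = 1) {p : ℕ} (hp : p.Prime) :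
    eulerCoeff x p = x p 1 := by
  simpa using eulerCoeff_prime_pow x hx hp 1

/-- `Λ` is multiplicative on coprime arguments. [folklore] -/
lemma eulerCoeff_mul_of_coprime (x : ℕ → ℕ → ℂ) {m n : ℕ} (hmn : m.Coprime n) :
    eulerCoeff x (m * n) = eulerCoeff x m * eulerCoeff x n := by
  rcases Nat.eq_zero_or_pos m with rfl | hm
  · simp only [Nat.coprime_zero_left] at hmn
    simp [hmn, eulerCoeff_one]
  rcases Nat.eq_zero_or_pos n with rfl | hn
  · simp only [Nat.coprime_zero_right] at hmn
    simp [hmn, eulerCoeff_one]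
  rw [eulerCoeff, Nat.factorization_mul hm.ne' hn.ne', Finsupp.prod_add_index_of_disjoint]
  · rfl
  · rw [Nat.support_factorization, Nat.support_factorization]
    exact hmn.disjoint_primeFactors

/-- **`T_m`-eigenvalues away from `n N`:** if `f ∈ S_k(N, ε)` satisfies `T_p f = c_p f` for all
primes `p ∤ N`, then `a_{m n} = Λ(m) a_n` for `m` prime to `n N`, where
`Λ(m) = ∏_{p^r ∥ m} recSeq c_p (ε(p)p^{k-1}) r` (Deligne–Serre (1.7.2); Diamond–Shurman
Prop. 5.8.5 for newforms). [cite: DiamondShurman2005, Prop. 5.2.2] -/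
theorem coeff_mul_eq_eulerCoeff (ε : DirichletCharacter ℂ N) (f : CuspForm (Gamma1 N) k)
    (hf : f ∈ nebentypusSubspace N k ε) (c : ℕ → ℂ)
    (heig : ∀ p : ℕ, (hp : p.Prime) → ¬ p ∣ N →
      (haveI : NeZero p := ⟨hp.ne_zero⟩; heckeT (Gamma1 N) k p f) = c p • f) :
    ∀ m : ℕ, m ≠ 0 → m.Coprime N → ∀ n : ℕ, m.Coprime n →
      (qExpansion 1 ⇑f).coeff (m * n) =
        eulerCoeff (fun p r ↦ recSeq (c p) (ε p * (p : ℂ) ^ (k - 1)) r) m *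
          (qExpansion 1 ⇑f).coeff n := by
  intro m
  induction m using Nat.recOnPrimePow with
  | zero => intro h; exact absurd rfl h
  | one => intro _ _ n _; simp [eulerCoeff_one]
  | prime_pow_mul a p r hp hpa hr ih =>
    intro h0 hcop n hn
    have ha0 : a ≠ 0 := right_ne_zero_of_mul h0
    have hpdvd : p ∣ p ^ r * a := Dvd.dvd.mul_right (dvd_pow_self p hr.ne') a
    have hpN : ¬ p ∣ N := hp.coprime_iff_not_dvd.mp (Nat.Coprime.coprime_dvd_left hpdvd hcop)
    have haN : a.Coprime N := Nat.Coprime.coprime_dvd_left (Dvd.intro_left _ rfl) hcop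
    have hpn : ¬ p ∣ n := hp.coprime_iff_not_dvd.mp (Nat.Coprime.coprime_dvd_left hpdvd hn)
    have han : a.Coprime n := Nat.Coprime.coprime_dvd_left (Dvd.intro_left _ rfl) hn
    have hpan : ¬ p ∣ a * n := fun h ↦ (hp.dvd_mul.mp h).elim hpa hpn
    rw [mul_assoc, coeff_prime_pow_mul ε f hf hp hpN (heig p hp hpN) hpan r, ih ha0 haN n han,
      eulerCoeff_mul_of_coprime _
        ((Nat.coprime_pow_left_iff hr _ _).mpr (hp.coprime_iff_not_dvd.mpr hpa)),
      eulerCoeff_prime_pow _ (fun q ↦ rfl) hp]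
    ring

/-! ### The local Rankin identity and estimate -/

/-- **Generating function of the tensor square** (the local Rankin identity, Deligne–Serre §5.2
"produit eulérien à quatre facteurs", cf. Shimura / Ogg [10, p. 33]): if
`∑ x_n x'_n Tⁿ` converges then
`(∑ x_n x'_n Tⁿ) · (1 - aa'T + (a²b' + a'²b - 2bb')T² - aa'bb'T³ + b²b'²T⁴) = 1 - bb'T²`,
the quartic being `∏ᵢⱼ (1 - λᵢ μⱼ T)` for the roots `λᵢ` of `X² - aX + b` and `μⱼ` of
`X² - a'X + b'`. [cite: DeligneSerreASENS1974, §5.2] -/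
theorem tsum_recSeq_mul_recSeq {a b a' b' T : ℂ}
    (h : Summable fun n ↦ recSeq a b n * recSeq a' b' n * T ^ n) :
    (∑' n, recSeq a b n * recSeq a' b' n * T ^ n) *
        (1 - a * a' * T + (a ^ 2 * b' + a' ^ 2 * b - 2 * b * b') * T ^ 2
          - a * a' * b * b' * T ^ 3 + b ^ 2 * b' ^ 2 * T ^ 4) =
      1 - b * b' * T ^ 2 := by
  set g : ℕ → ℂ := fun n ↦ recSeq a b n * recSeq a' b' n * T ^ n with hg
  have hS : HasSum g (∑' n, g n) := h.hasSum
  have h1 := (hasSum_nat_add_iff' 1).mpr hS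
  have h2 := (hasSum_nat_add_iff' 2).mpr hS
  have h3 := (hasSum_nat_add_iff' 3).mpr hS
  have h4 := (hasSum_nat_add_iff' 4).mpr hS
  have hcomb := (((h4.sub (h3.mul_left (a * a' * T))).add
    (h2.mul_left ((a ^ 2 * b' + a' ^ 2 * b - 2 * b * b') * T ^ 2))).sub
    (h1.mul_left (a * a' * b * b' * T ^ 3))).add (hS.mul_left (b ^ 2 * b' ^ 2 * T ^ 4))
  have hzero : (fun n ↦ g (n + 4) - a * a' * T * g (n + 3) +
      (a ^ 2 * b' + a' ^ 2 * b - 2 * b * b') * T ^ 2 * g (n + 2) -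
      a * a' * b * b' * T ^ 3 * g (n + 1) + b ^ 2 * b' ^ 2 * T ^ 4 * g n) = fun _ ↦ 0 := by
    funext n
    simp only [hg, recSeq_mul_recSeq_rec a b a' b' n]
    ring
  rw [hzero] at hcomb
  have h0 := hcomb.unique hasSum_zero
  simp only [Finset.sum_range_succ, Finset.sum_range_zero, hg, recSeq_zero, recSeq_one,
    recSeq_add_two, zero_add] at h0
  linear_combination h0

/-- `recSeq` commutes with complex conjugation. [folklore] -/
lemma conj_recSeq (a b : ℂ) (n : ℕ) : conj (recSeq a b n) = recSeq (conj a) (conj b) n :=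
  map_recSeq a b (starRingEnd ℂ) n

/-- The quartic `∏ᵢⱼ (1 - λᵢ μ̄ⱼ T)` of the tensor square with the conjugate sequence, in terms of
the roots `α, β`: it equals `(1 - |α|²T)(1 - |β|²T)|1 - αβ̄T|²` (real). [folklore] -/
lemma quartic_eq_of_roots (α β : ℂ) (T : ℝ) :
    (1 - (α + β) * (conj α + conj β) * T +
        ((α + β) ^ 2 * (conj α * conj β) + (conj α + conj β) ^ 2 * (α * β)
          - 2 * (α * β) * (conj α * conj β)) * T ^ 2
        - (α + β) * (conj α + conj β) * (α * β) * (conj α * conj β) * T ^ 3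
        + (α * β) ^ 2 * (conj α * conj β) ^ 2 * T ^ 4 : ℂ) =
      (((1 - ‖α‖ ^ 2 * T) * (1 - ‖β‖ ^ 2 * T) * ‖1 - α * conj β * T‖ ^ 2 : ℝ) : ℂ) := by
  have hn : ∀ z : ℂ, ((‖z‖ : ℂ)) ^ 2 = z * conj z := fun z ↦ by
    rw [← Complex.ofReal_pow, ← Complex.normSq_eq_norm_sq, Complex.mul_conj]
  push_cast
  rw [hn, hn, hn]
  simp only [map_sub, map_one, map_mul, Complex.conj_conj, Complex.conj_ofReal]
  ring

/-- **The local majorant** `(1 - |α|²T)(1 - |β|²T)|1 - αβ̄T|² ≤ exp(-|α + β|² T)` for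
`0 ≤ T`, `|α|²T < 1`, `|β|²T < 1`: minus the logarithm of the left side is
`∑_{m ≥ 1} |αᵐ + βᵐ|² Tᵐ/m ≥ |α + β|² T` (Deligne–Serre §5.2: `log L(s) = ∑ |Tr φ_pᵐ|² p^{-ms}/m`
has non-negative coefficients and `g₁ ≤ g`). [cite: DeligneSerreASENS1974, §5.2] -/
theorem quartic_le_exp (α β : ℂ) {T : ℝ} (hT : 0 ≤ T) (hα : ‖α‖ ^ 2 * T < 1)
    (hβ : ‖β‖ ^ 2 * T < 1) :
    (1 - ‖α‖ ^ 2 * T) * (1 - ‖β‖ ^ 2 * T) * ‖1 - α * conj β * T‖ ^ 2 ≤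
      Real.exp (-(‖α + β‖ ^ 2 * T)) := by
  set x₁ : ℝ := ‖α‖ ^ 2 * T with hx₁
  set x₂ : ℝ := ‖β‖ ^ 2 * T with hx₂
  set w : ℂ := α * conj β * T with hw
  have hx₁0 : 0 ≤ x₁ := by positivity
  have hx₂0 : 0 ≤ x₂ := by positivity
  have hwn' : ‖w‖ = ‖α‖ * ‖β‖ * T := by
    rw [hw, norm_mul, norm_mul, Complex.norm_conj, Complex.norm_real, Real.norm_of_nonneg hT]
  have hwn : ‖w‖ < 1 := by
    rw [hwn']
    have h1 : (‖α‖ * ‖β‖ * T) ^ 2 < 1 := by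
      calc (‖α‖ * ‖β‖ * T) ^ 2 = (‖α‖ ^ 2 * T) * (‖β‖ ^ 2 * T) := by ring
        _ < 1 * 1 := mul_lt_mul'' hα hβ (by positivity) (by positivity)
        _ = 1 := one_mul 1
    nlinarith [h1, show 0 ≤ ‖α‖ * ‖β‖ * T by positivity]
  have hw1 : 0 < ‖1 - w‖ := by
    rw [norm_pos_iff, sub_ne_zero]
    intro h
    rw [← h, norm_one] at hwn
    exact lt_irrefl _ hwn
  -- the three logarithmic series `∑ zⁿ/n = -log (1 - z)`
  have H1 := Complex.hasSum_taylorSeries_neg_log (z := (x₁ : ℂ))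
    (by rw [Complex.norm_real, Real.norm_of_nonneg hx₁0]; exact hα)
  have H2 := Complex.hasSum_taylorSeries_neg_log (z := (x₂ : ℂ))
    (by rw [Complex.norm_real, Real.norm_of_nonneg hx₂0]; exact hβ)
  have H3 := Complex.hasSum_taylorSeries_neg_log hwn
  have R := Complex.hasSum_re ((H1.add H2).add (H3.add H3))
  -- the value
  have hval : (-Complex.log (1 - (x₁ : ℂ)) + -Complex.log (1 - (x₂ : ℂ)) +
      (-Complex.log (1 - w) + -Complex.log (1 - w))).re =
      -(Real.log (1 - x₁) + Real.log (1 - x₂) + 2 * Real.log ‖1 - w‖) := by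
    have e1 : (1 : ℂ) - (x₁ : ℂ) = ((1 - x₁ : ℝ) : ℂ) := by push_cast; rfl
    have e2 : (1 : ℂ) - (x₂ : ℂ) = ((1 - x₂ : ℝ) : ℂ) := by push_cast; rfl
    simp only [Complex.add_re, Complex.neg_re, Complex.log_re, e1, e2, Complex.norm_real,
      Real.norm_of_nonneg (show 0 ≤ 1 - x₁ by linarith),
      Real.norm_of_nonneg (show 0 ≤ 1 - x₂ by linarith)]
    ring
  -- the terms are `|αⁿ + βⁿ|² Tⁿ / n ≥ 0`
  have hnonneg : ∀ n : ℕ, 0 ≤ ((x₁ : ℂ) ^ n / n + (x₂ : ℂ) ^ n / n + (w ^ n / n + w ^ n / n)).re := by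
    intro n
    simp only [Complex.add_re, Complex.div_natCast_re, ← Complex.ofReal_pow, Complex.ofReal_re]
    rw [show x₁ ^ n / n + x₂ ^ n / n + ((w ^ n).re / n + (w ^ n).re / n) =
      (x₁ ^ n + x₂ ^ n + 2 * (w ^ n).re) / n by ring]
    refine div_nonneg ?_ (Nat.cast_nonneg n)
    have hre : -(‖w‖ ^ n) ≤ (w ^ n).re := by
      have h := abs_re_le_norm (w ^ n)
      rw [norm_pow] at h
      exact (abs_le.mp h).1
    have key : (‖α‖ ^ 2 * T) ^ n + (‖β‖ ^ 2 * T) ^ n - 2 * (‖α‖ * ‖β‖ * T) ^ n =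
        T ^ n * (‖α‖ ^ n - ‖β‖ ^ n) ^ 2 := by ring
    have key' : 0 ≤ T ^ n * (‖α‖ ^ n - ‖β‖ ^ n) ^ 2 := by positivity
    rw [hwn'] at hre
    rw [hx₁, hx₂]
    linarith
  -- the first term is `|α + β|² T`
  have hone : ((x₁ : ℂ) ^ 1 / (1 : ℕ) + (x₂ : ℂ) ^ 1 / (1 : ℕ) + (w ^ 1 / (1 : ℕ) + w ^ 1 / (1 : ℕ))).re =
      ‖α + β‖ ^ 2 * T := by
    simp only [pow_one, Nat.cast_one, div_one, Complex.add_re, Complex.ofReal_re, hw,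
      Complex.re_mul_ofReal, hx₁, hx₂]
    rw [← Complex.normSq_eq_norm_sq (α + β), Complex.normSq_add, Complex.normSq_eq_norm_sq,
      Complex.normSq_eq_norm_sq]
    ring
  have hle := le_hasSum R 1 (fun n _ ↦ hnonneg n)
  rw [hone, hval] at hle
  have hpos : 0 < (1 - x₁) * (1 - x₂) * ‖1 - w‖ ^ 2 :=
    mul_pos (mul_pos (by linarith) (by linarith)) (pow_pos hw1 2)
  rw [← Real.log_le_iff_le_exp hpos, Real.log_mul (mul_pos (by linarith) (by linarith)).ne'
    (pow_pos hw1 2).ne', Real.log_mul (by linarith : 1 - x₁ ≠ 0) (by linarith : 1 - x₂ ≠ 0),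
    Real.log_pow]
  push_cast
  linarith

/-- `x x̄ Tⁿ = |x|² Tⁿ` as a real number cast to `ℂ`. [folklore] -/
lemma mul_conj_mul_pow (x : ℂ) (T : ℝ) (n : ℕ) :
    x * conj x * (T : ℂ) ^ n = ((‖x‖ ^ 2 * T ^ n : ℝ) : ℂ) := by
  rw [Complex.mul_conj, Complex.normSq_eq_norm_sq]
  push_cast
  ring

/-- **Root bound.** If `|x_n| ≤ M ρⁿ` for the solution `x_n = ∑_{i+j=n} αⁱβʲ` of the recurrence
with roots `α, β`, then `|α| ≤ ρ` (from `α^{n+1} = x_{n+1} - β x_n`). [folklore] -/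
theorem norm_root_le {α β : ℂ} {ρ M : ℝ} (hρ : 0 < ρ)
    (hbdd : ∀ n, ‖recSeq (α + β) (α * β) n‖ ≤ M * ρ ^ n) : ‖α‖ ≤ ρ := by
  refine le_of_not_gt fun hlt ↦ ?_
  have hM : 1 ≤ M := by simpa using hbdd 0
  have hα0 : 0 < ‖α‖ := hρ.trans hlt
  have hpow : ∀ n, ‖α‖ ^ (n + 1) ≤ M * (ρ + ‖β‖) * ρ ^ n := fun n ↦ by
    calc ‖α‖ ^ (n + 1) = ‖recSeq (α + β) (α * β) (n + 1) - β * recSeq (α + β) (α * β) n‖ := by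
          rw [recSeq_succ_sub_mul, norm_pow]
      _ ≤ ‖recSeq (α + β) (α * β) (n + 1)‖ + ‖β‖ * ‖recSeq (α + β) (α * β) n‖ := by
          refine (norm_sub_le _ _).trans ?_
          rw [norm_mul]
      _ ≤ M * ρ ^ (n + 1) + ‖β‖ * (M * ρ ^ n) := by
          gcongr
          · exact hbdd (n + 1)
          · exact hbdd n
      _ = M * (ρ + ‖β‖) * ρ ^ n := by ring
  have hq : 1 < ‖α‖ / ρ := (one_lt_div hρ).mpr hlt
  obtain ⟨n, hn⟩ := ((tendsto_pow_atTop_atTop_of_one_lt hq).eventually_gt_atTop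
    (M * (ρ + ‖β‖) / ‖α‖)).exists
  have h2 : M * (ρ + ‖β‖) * ρ ^ n < ‖α‖ ^ (n + 1) := by
    have h3 := mul_lt_mul_of_pos_right hn (mul_pos hα0 (pow_pos hρ n))
    calc M * (ρ + ‖β‖) * ρ ^ n = M * (ρ + ‖β‖) / ‖α‖ * (‖α‖ * ρ ^ n) := by
          field_simp
      _ < (‖α‖ / ρ) ^ n * (‖α‖ * ρ ^ n) := h3
      _ = ‖α‖ ^ (n + 1) := by
          rw [div_pow, pow_succ]
          field_simp
  linarith [hpow n]

/-- Bounded terms of `∑ |x_n|² T'ⁿ` give `|x_n| ≤ M (T'^{-1/2})ⁿ`. [folklore] -/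
lemma norm_le_of_summable {x : ℕ → ℂ} {T' : ℝ} (hT' : 0 < T')
    (hsum' : Summable fun n ↦ ‖x n‖ ^ 2 * T' ^ n) :
    ∀ n, ‖x n‖ ≤ Real.sqrt (∑' n, ‖x n‖ ^ 2 * T' ^ n) * Real.sqrt T'⁻¹ ^ n := by
  intro n
  set S := ∑' n, ‖x n‖ ^ 2 * T' ^ n with hS
  have hle : ‖x n‖ ^ 2 * T' ^ n ≤ S :=
    hsum'.le_tsum n (fun m _ ↦ by positivity)
  have hS0 : 0 ≤ S := le_trans (by positivity) hle
  have h1 : ‖x n‖ ^ 2 ≤ S * (Real.sqrt T'⁻¹ ^ n) ^ 2 := by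
    rw [← pow_mul, mul_comm n 2, pow_mul, Real.sq_sqrt (inv_nonneg.mpr hT'.le), inv_pow,
      ← div_eq_mul_inv, le_div_iff₀ (pow_pos hT' n)]
    exact hle
  calc ‖x n‖ = Real.sqrt (‖x n‖ ^ 2) := (Real.sqrt_sq (norm_nonneg _)).symm
    _ ≤ Real.sqrt (S * (Real.sqrt T'⁻¹ ^ n) ^ 2) := Real.sqrt_le_sqrt h1
    _ = Real.sqrt S * Real.sqrt T'⁻¹ ^ n := by
        rw [Real.sqrt_mul hS0, Real.sqrt_sq (by positivity)]

/-- **The local estimate** (Deligne–Serre §5.2, one Euler factor): if `∑ₙ |x_n|² Tⁿ` converges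
for `x_n = recSeq a b n` at `T` and at some `T' > T > 0`, then `|b|² T² < 1` and
`|a|² T + log (1 - |b|²T²) ≤ log ∑ₙ |x_n|² Tⁿ`
(i.e. `∑ |x_n|² Tⁿ = (1 - |b|²T²)/∏ᵢⱼ(1 - λᵢλ̄ⱼT) ≥ (1 - |b|²T²) exp(|a|²T)`).
[cite: DeligneSerreASENS1974, §5.2] -/
theorem local_estimate {a b : ℂ} {T T' : ℝ} (hT : 0 < T) (hTT' : T < T')
    (hsum : Summable fun n ↦ ‖recSeq a b n‖ ^ 2 * T ^ n)
    (hsum' : Summable fun n ↦ ‖recSeq a b n‖ ^ 2 * T' ^ n) :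
    ‖b‖ ^ 2 * T ^ 2 < 1 ∧
      ‖a‖ ^ 2 * T + Real.log (1 - ‖b‖ ^ 2 * T ^ 2) ≤
        Real.log (∑' n, ‖recSeq a b n‖ ^ 2 * T ^ n) := by
  -- roots of `X² - aX + b`
  obtain ⟨δ, hδ⟩ := IsAlgClosed.exists_pow_nat_eq (a ^ 2 - 4 * b) two_pos
  set α : ℂ := (a + δ) / 2 with hαdef
  set β : ℂ := (a - δ) / 2 with hβdef
  have hab : α + β = a := by rw [hαdef, hβdef]; ring
  have hαβ : α * β = b := by
    rw [hαdef, hβdef]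
    linear_combination (-(1 : ℂ) / 4) * hδ
  rw [← hab, ← hαβ] at hsum hsum' ⊢
  -- root bounds
  have hT' : 0 < T' := hT.trans hTT'
  set ρ : ℝ := Real.sqrt T'⁻¹ with hρ
  have hρ0 : 0 < ρ := Real.sqrt_pos.mpr (inv_pos.mpr hT')
  have hρ2 : ρ ^ 2 = T'⁻¹ := Real.sq_sqrt (inv_nonneg.mpr hT'.le)
  have hbα := norm_le_of_summable hT' hsum'
  have hαle : ‖α‖ ≤ ρ := norm_root_le hρ0 hbα
  have hβle : ‖β‖ ≤ ρ := by
    refine norm_root_le (β := α)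
      (M := Real.sqrt (∑' n, ‖recSeq (α + β) (α * β) n‖ ^ 2 * T' ^ n)) hρ0 fun n ↦ ?_
    rw [add_comm β α, mul_comm β α]
    exact hbα n
  have hroot : ∀ γ : ℂ, ‖γ‖ ≤ ρ → ‖γ‖ ^ 2 * T < 1 := fun γ hγ ↦ by
    have h1 : ‖γ‖ ^ 2 ≤ T'⁻¹ := hρ2 ▸ pow_le_pow_left₀ (norm_nonneg _) hγ 2
    calc ‖γ‖ ^ 2 * T ≤ T'⁻¹ * T := by gcongr
      _ < 1 := by rw [inv_mul_lt_iff₀ hT']; simpa using hTT'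
  have hα1 := hroot α hαle
  have hβ1 := hroot β hβle
  have hb1 : ‖α * β‖ ^ 2 * T ^ 2 < 1 := by
    rw [norm_mul]
    calc (‖α‖ * ‖β‖) ^ 2 * T ^ 2 = (‖α‖ ^ 2 * T) * (‖β‖ ^ 2 * T) := by ring
      _ < 1 * 1 := mul_lt_mul'' hα1 hβ1 (by positivity) (by positivity)
      _ = 1 := one_mul 1
  refine ⟨hb1, ?_⟩
  -- the identity `W · Q = 1 - |b|² T²`
  set W : ℝ := ∑' n, ‖recSeq (α + β) (α * β) n‖ ^ 2 * T ^ n with hW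
  set Q : ℝ := (1 - ‖α‖ ^ 2 * T) * (1 - ‖β‖ ^ 2 * T) * ‖1 - α * conj β * T‖ ^ 2 with hQ
  have hsumC : Summable fun n ↦ recSeq (α + β) (α * β) n *
      recSeq (conj α + conj β) (conj α * conj β) n * (T : ℂ) ^ n := by
    have h := (Complex.summable_ofReal.mpr hsum)
    refine h.congr fun n ↦ ?_
    rw [← map_add, ← map_mul, ← conj_recSeq, mul_conj_mul_pow]
  have hident := tsum_recSeq_mul_recSeq hsumC
  have htsum : (∑' n, recSeq (α + β) (α * β) n * recSeq (conj α + conj β) (conj α * conj β) n *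
      (T : ℂ) ^ n) = (W : ℂ) := by
    rw [hW, Complex.ofReal_tsum]
    refine tsum_congr fun n ↦ ?_
    rw [← map_add, ← map_mul, ← conj_recSeq, mul_conj_mul_pow]
  rw [htsum, quartic_eq_of_roots α β T] at hident
  have hidentR : W * Q = 1 - ‖α * β‖ ^ 2 * T ^ 2 := by
    have h2 : ((α * β) * (conj α * conj β) : ℂ) = ((‖α * β‖ ^ 2 : ℝ) : ℂ) := by
      rw [← map_mul, Complex.mul_conj, Complex.normSq_eq_norm_sq]
    rw [h2] at hident
    exact_mod_cast hident
  -- positivity and the exponential bound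
  have hw1 : 0 < ‖1 - α * conj β * T‖ := by
    rw [norm_pos_iff, sub_ne_zero]
    intro h
    have : ‖α * conj β * (T : ℂ)‖ < 1 := by
      rw [norm_mul, norm_mul, Complex.norm_conj, Complex.norm_real, Real.norm_of_nonneg hT.le]
      have h1 : (‖α‖ * ‖β‖ * T) ^ 2 < 1 := by
        calc (‖α‖ * ‖β‖ * T) ^ 2 = (‖α‖ ^ 2 * T) * (‖β‖ ^ 2 * T) := by ring
          _ < 1 * 1 := mul_lt_mul'' hα1 hβ1 (by positivity) (by positivity)
          _ = 1 := one_mul 1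
      nlinarith [h1, show 0 ≤ ‖α‖ * ‖β‖ * T by positivity]
    rw [← h, norm_one] at this
    exact lt_irrefl _ this
  have hQpos : 0 < Q := mul_pos (mul_pos (by linarith) (by linarith)) (pow_pos hw1 2)
  have hQle : Q ≤ Real.exp (-(‖α + β‖ ^ 2 * T)) := quartic_le_exp α β hT.le hα1 hβ1
  have hc0 : 0 < 1 - ‖α * β‖ ^ 2 * T ^ 2 := by linarith
  have hWeq : W = (1 - ‖α * β‖ ^ 2 * T ^ 2) / Q := by
    rw [eq_div_iff hQpos.ne', hidentR]
  have hlogQ : Real.log Q ≤ -(‖α + β‖ ^ 2 * T) := (Real.log_le_iff_le_exp hQpos).mpr hQle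
  rw [hWeq, Real.log_div hc0.ne' hQpos.ne']
  linarith

/-! ## D. Assembly of Prop. 5.1 -/

/-! ### Vanishing criteria and the Dirichlet series `∑ |a_n|² n^{-s}` -/

/-- A `Γ₁(N)`-cusp form with vanishing `q`-expansion is zero. [folklore] -/
lemma eq_zero_of_coeff_eq_zero (f : CuspForm (Gamma1 N) k)
    (h : ∀ n, (qExpansion 1 ⇑f).coeff n = 0) : f = 0 := by
  ext τ
  have hs := hasSum_qExpansion_Gamma1 N k f τ
  simp only [h, zero_smul] at hs
  simpa using hs.unique hasSum_zero

/-- **Cusp forms of negative weight vanish** (here from the Parseval bound: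
`|a_n|² e^{-4πnt} ≤ C t^{-k} → 0` as `t → 0⁺` when `k < 0`). [folklore] -/
theorem eq_zero_of_weight_neg (hk : k < 0) (f : CuspForm (Gamma1 N) k) : f = 0 := by
  obtain ⟨C, hC, hA⟩ := sum_sq_coeff_exp_le f
  refine eq_zero_of_coeff_eq_zero f fun n ↦ ?_
  by_contra hn
  set B : ℝ := ‖(qExpansion 1 ⇑f).coeff n‖ ^ 2 * Real.exp (-4 * π * n) with hB
  have hB0 : 0 < B := mul_pos (pow_pos (norm_pos_iff.mpr hn) 2) (Real.exp_pos _)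
  set t : ℝ := min 1 (B / (2 * C)) with ht
  have ht0 : 0 < t := lt_min one_pos (by positivity)
  have ht1 : t ≤ 1 := min_le_left _ _
  have h1 := hA t ht0 {n}
  rw [Finset.sum_singleton] at h1
  have h2 : B ≤ ‖(qExpansion 1 ⇑f).coeff n‖ ^ 2 * Real.exp (-4 * π * n * t) := by
    apply mul_le_mul_of_nonneg_left _ (by positivity)
    apply Real.exp_le_exp.mpr
    have : 0 ≤ 4 * π * n * (1 - t) := by
      have := Real.pi_pos.le
      have : (0 : ℝ) ≤ n := Nat.cast_nonneg n
      have : 0 ≤ 1 - t := by linarith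
      positivity
    linarith
  have h3 : C * t ^ (-k) ≤ C * t := by
    have h := zpow_le_zpow_right_of_le_one₀ ht0 ht1 (show (1 : ℤ) ≤ -k by omega)
    rw [zpow_one] at h
    exact mul_le_mul_of_nonneg_left h hC.le
  have h4 : C * t ≤ B / 2 := by
    calc C * t ≤ C * (B / (2 * C)) := by gcongr; exact min_le_right _ _
      _ = B / 2 := by field_simp
  linarith

/-- A non-zero cusp form has a non-zero coefficient `a_{n₀}`, `n₀ ≥ 1`. [folklore] -/
lemma exists_coeff_ne_zero {f : CuspForm (Gamma1 N) k} (hf : f ≠ 0) :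
    ∃ n₀ : ℕ, n₀ ≠ 0 ∧ (qExpansion 1 ⇑f).coeff n₀ ≠ 0 := by
  by_contra h
  push Not at h
  refine hf (eq_zero_of_coeff_eq_zero f fun n ↦ ?_)
  rcases Nat.eq_zero_or_pos n with rfl | hn
  · exact CuspFormClass.qExpansion_coeff_zero f one_pos (one_mem_strictPeriods_Gamma1 N)
  · exact h n hn.ne'

omit [NeZero N] in
/-- For `s > max(k, 0)` the series `∑ |a_n|² n^{-s}` converges, with the dyadic bound. [folklore] -/
lemma summable_sq_coeff_rpow (f : CuspForm (Gamma1 N) k) {C : ℝ}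
    (hC : ∀ s : ℝ, 0 < s → (k : ℝ) < s → ∀ F : Finset ℕ,
      ∑ n ∈ F, ‖(qExpansion 1 ⇑f).coeff n‖ ^ 2 * (n : ℝ) ^ (-s) ≤
        C * (2 : ℝ) ^ s / (1 - (2 : ℝ) ^ ((k : ℝ) - s)))
    {s : ℝ} (hs : 0 < s) (hks : (k : ℝ) < s) :
    Summable (fun n ↦ ‖(qExpansion 1 ⇑f).coeff n‖ ^ 2 * (n : ℝ) ^ (-s)) ∧
      ∑' n, ‖(qExpansion 1 ⇑f).coeff n‖ ^ 2 * (n : ℝ) ^ (-s) ≤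
        C * (2 : ℝ) ^ s / (1 - (2 : ℝ) ^ ((k : ℝ) - s)) :=
  ⟨summable_of_sum_le (fun n ↦ by positivity) (hC s hs hks),
    Real.tsum_le_of_sum_le (fun n ↦ by positivity) (hC s hs hks)⟩

/-! ### The multiplicative weight `g_s` -/

/-- The Hecke parameters `x_p(r) = recSeq c_p (ε(p) p^{k-1}) r` (`= λ(p^r)`, the `T_{p^r}`-eigenvalue,
Deligne–Serre (1.7.2)). [cite: DeligneSerreASENS1974, (1.7.2)] -/
def heckeSeq (c : ℕ → ℂ) (ε : DirichletCharacter ℂ N) (k : ℤ) (p r : ℕ) : ℂ :=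
  recSeq (c p) (ε p * (p : ℂ) ^ (k - 1)) r

omit [NeZero N] in
/-- `x_p(0) = 1`. [folklore] -/
@[simp] lemma heckeSeq_zero (c : ℕ → ℂ) (ε : DirichletCharacter ℂ N) (k : ℤ) (p : ℕ) :
    heckeSeq c ε k p 0 = 1 := rfl

omit [NeZero N] in
/-- `x_p(1) = c_p`. [folklore] -/
@[simp] lemma heckeSeq_one (c : ℕ → ℂ) (ε : DirichletCharacter ℂ N) (k : ℤ) (p : ℕ) :
    heckeSeq c ε k p 1 = c p := rfl

/-- The weight `g_s(m) = 𝟙[m ≥ 1, (m, L) = 1] · |Λ(m)|² m^{-s}`, `Λ(m) = ∏_{p^r ∥ m} x_p(r)`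
(for `L = n₀ N` these are `|a_{m n₀} / a_{n₀}|² m^{-s}`). [folklore] -/
def weight (c : ℕ → ℂ) (ε : DirichletCharacter ℂ N) (k : ℤ) (L : ℕ) (s : ℝ) (m : ℕ) : ℝ :=
  if m ≠ 0 ∧ m.Coprime L then ‖eulerCoeff (heckeSeq c ε k) m‖ ^ 2 * (m : ℝ) ^ (-s) else 0

section weight

omit [NeZero N]

variable (c : ℕ → ℂ) (ε : DirichletCharacter ℂ N) (k : ℤ) (L : ℕ) (s : ℝ)

/-- `g_s ≥ 0`. [folklore] -/
lemma weight_nonneg (m : ℕ) : 0 ≤ weight c ε k L s m := by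
  unfold weight
  split_ifs <;> positivity

/-- `g_s(1) = 1`. [folklore] -/
lemma weight_one : weight c ε k L s 1 = 1 := by
  simp [weight, eulerCoeff_one]

/-- `g_s` is multiplicative on coprime arguments. [folklore] -/
lemma weight_mul_of_coprime {m n : ℕ} (hmn : m.Coprime n) :
    weight c ε k L s (m * n) = weight c ε k L s m * weight c ε k L s n := by
  rcases Nat.eq_zero_or_pos m with rfl | hm
  · simp only [Nat.coprime_zero_left] at hmn
    simp [hmn, weight_one]
  rcases Nat.eq_zero_or_pos n with rfl | hn
  · simp only [Nat.coprime_zero_right] at hmn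
    simp [hmn, weight_one]
  unfold weight
  by_cases hmL : m.Coprime L
  · by_cases hnL : n.Coprime L
    · rw [if_pos ⟨(Nat.mul_pos hm hn).ne', Nat.Coprime.mul_left hmL hnL⟩, if_pos ⟨hm.ne', hmL⟩,
        if_pos ⟨hn.ne', hnL⟩, eulerCoeff_mul_of_coprime _ hmn, norm_mul, Nat.cast_mul,
        Real.mul_rpow (Nat.cast_nonneg m) (Nat.cast_nonneg n)]
      ring
    · rw [if_neg (fun h ↦ hnL (Nat.Coprime.coprime_mul_left h.2)), if_pos ⟨hm.ne', hmL⟩,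
        if_neg (fun h ↦ hnL h.2), mul_zero]
  · rw [if_neg (fun h ↦ hmL (Nat.Coprime.coprime_mul_right h.2)), if_neg (fun h ↦ hmL h.2),
      zero_mul]

/-- `(p^r)^{-s} = (p^{-s})^r`. [folklore] -/
lemma natCast_pow_rpow_neg (p r : ℕ) (s : ℝ) :
    ((p ^ r : ℕ) : ℝ) ^ (-s) = ((p : ℝ) ^ (-s)) ^ r := by
  rw [Nat.cast_pow, ← Real.rpow_natCast (p : ℝ) r, ← Real.rpow_mul (Nat.cast_nonneg p), mul_comm,
    Real.rpow_mul_natCast (Nat.cast_nonneg p)]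

/-- `g_s(p^r) = |x_p(r)|² (p^{-s})^r` for `p ∤ L`. [folklore] -/
lemma weight_prime_pow {p : ℕ} (hp : p.Prime) (hpL : ¬ p ∣ L) (r : ℕ) :
    weight c ε k L s (p ^ r) = ‖heckeSeq c ε k p r‖ ^ 2 * ((p : ℝ) ^ (-s)) ^ r := by
  unfold weight
  rw [if_pos ⟨pow_ne_zero r hp.ne_zero, Nat.Coprime.pow_left r (hp.coprime_iff_not_dvd.mpr hpL)⟩,
    eulerCoeff_prime_pow _ (fun q ↦ rfl) hp, natCast_pow_rpow_neg]

/-- `g_s(p) = |c_p|² p^{-s}` for `p ∤ L`. [folklore] -/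
lemma weight_prime {p : ℕ} (hp : p.Prime) (hpL : ¬ p ∣ L) :
    weight c ε k L s p = ‖c p‖ ^ 2 * (p : ℝ) ^ (-s) := by
  simpa using weight_prime_pow c ε k L s hp hpL 1

end weight

/-! ### The weight in terms of the coefficients of `f` -/

section link

variable (ε : DirichletCharacter ℂ N) (f : CuspForm (Gamma1 N) k)
  (hf : f ∈ nebentypusSubspace N k ε) (c : ℕ → ℂ)
  (heig : ∀ p : ℕ, (hp : p.Prime) → ¬ p ∣ N →
    (haveI : NeZero p := ⟨hp.ne_zero⟩; heckeT (Gamma1 N) k p f) = c p • f)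
  {n₀ : ℕ} (hn₀ : (qExpansion 1 ⇑f).coeff n₀ ≠ 0)

include hf heig hn₀

/-- For `m ≥ 1` prime to `n₀ N`: `g_s(m) = (n₀^s / |a_{n₀}|²) · |a_{m n₀}|² (m n₀)^{-s}`, and `g_s ≤`
this quantity in general. [folklore] -/
lemma weight_le (s : ℝ) (m : ℕ) :
    weight c ε k (n₀ * N) s m ≤ ((n₀ : ℝ) ^ s / ‖(qExpansion 1 ⇑f).coeff n₀‖ ^ 2) *
      (‖(qExpansion 1 ⇑f).coeff (m * n₀)‖ ^ 2 * ((m * n₀ : ℕ) : ℝ) ^ (-s)) := by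
  unfold weight
  split_ifs with h
  · obtain ⟨hm, hcop⟩ := h
    have hmN : m.Coprime N := Nat.Coprime.coprime_dvd_right (Dvd.intro_left n₀ rfl) hcop
    have hmn₀ : m.Coprime n₀ := Nat.Coprime.coprime_dvd_right (Dvd.intro N rfl) hcop
    have key := coeff_mul_eq_eulerCoeff ε f hf c heig m hm hmN n₀ hmn₀
    have hn0 : n₀ ≠ 0 := by
      rintro rfl
      exact hn₀ (CuspFormClass.qExpansion_coeff_zero f one_pos (one_mem_strictPeriods_Gamma1 N))
    have hb : 0 < ‖(qExpansion 1 ⇑f).coeff n₀‖ := norm_pos_iff.mpr hn₀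
    have hΛ : ‖eulerCoeff (heckeSeq c ε k) m‖ ^ 2 =
        ‖(qExpansion 1 ⇑f).coeff (m * n₀)‖ ^ 2 / ‖(qExpansion 1 ⇑f).coeff n₀‖ ^ 2 := by
      rw [key, norm_mul, mul_pow, mul_div_assoc, div_self (pow_pos hb 2).ne', mul_one]
      rfl
    have hrpow : (m : ℝ) ^ (-s) = (n₀ : ℝ) ^ s * ((m * n₀ : ℕ) : ℝ) ^ (-s) := by
      rw [Nat.cast_mul, Real.mul_rpow (Nat.cast_nonneg m) (Nat.cast_nonneg n₀),
        Real.rpow_neg (Nat.cast_nonneg n₀)]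
      have : (n₀ : ℝ) ^ s ≠ 0 := (Real.rpow_pos_of_pos (by exact_mod_cast Nat.pos_of_ne_zero hn0) s).ne'
      field_simp
    rw [hΛ, hrpow]
    apply le_of_eq
    field_simp
  · apply mul_nonneg (div_nonneg (Real.rpow_nonneg (Nat.cast_nonneg n₀) s) (sq_nonneg _))
    positivity

/-- The weights are summable for `s > max(k, 0)`, with `∑ g_s ≤ (n₀^s/|a_{n₀}|²) ∑ |a_n|² n^{-s}`.
[folklore] -/
lemma summable_weight {s : ℝ}
    (hD : Summable fun n ↦ ‖(qExpansion 1 ⇑f).coeff n‖ ^ 2 * (n : ℝ) ^ (-s)) :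
    Summable (weight c ε k (n₀ * N) s) ∧
      ∑' m, weight c ε k (n₀ * N) s m ≤ ((n₀ : ℝ) ^ s / ‖(qExpansion 1 ⇑f).coeff n₀‖ ^ 2) *
        ∑' n, ‖(qExpansion 1 ⇑f).coeff n‖ ^ 2 * (n : ℝ) ^ (-s) := by
  have hn0 : n₀ ≠ 0 := by
    rintro rfl
    exact hn₀ (CuspFormClass.qExpansion_coeff_zero f one_pos (one_mem_strictPeriods_Gamma1 N))
  have hinj : Function.Injective fun m : ℕ ↦ m * n₀ := mul_left_injective₀ hn0
  have hD' : Summable fun m : ℕ ↦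
      ‖(qExpansion 1 ⇑f).coeff (m * n₀)‖ ^ 2 * ((m * n₀ : ℕ) : ℝ) ^ (-s) :=
    hD.comp_injective hinj
  have hK : 0 ≤ (n₀ : ℝ) ^ s / ‖(qExpansion 1 ⇑f).coeff n₀‖ ^ 2 :=
    div_nonneg (Real.rpow_nonneg (Nat.cast_nonneg n₀) s) (sq_nonneg _)
  have hle := weight_le ε f hf c heig hn₀ s
  have hsum : Summable (weight c ε k (n₀ * N) s) :=
    (hD'.mul_left _).of_nonneg_of_le (weight_nonneg c ε k _ s) hle
  refine ⟨hsum, ?_⟩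
  calc ∑' m, weight c ε k (n₀ * N) s m
      ≤ ∑' m : ℕ, ((n₀ : ℝ) ^ s / ‖(qExpansion 1 ⇑f).coeff n₀‖ ^ 2) *
          (‖(qExpansion 1 ⇑f).coeff (m * n₀)‖ ^ 2 * ((m * n₀ : ℕ) : ℝ) ^ (-s)) :=
        hsum.tsum_le_tsum hle (hD'.mul_left _)
    _ = ((n₀ : ℝ) ^ s / ‖(qExpansion 1 ⇑f).coeff n₀‖ ^ 2) *
          ∑' m : ℕ, ‖(qExpansion 1 ⇑f).coeff (m * n₀)‖ ^ 2 * ((m * n₀ : ℕ) : ℝ) ^ (-s) :=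
        tsum_mul_left
    _ ≤ _ := by
        have h5 : ∑' m : ℕ, ‖(qExpansion 1 ⇑f).coeff (m * n₀)‖ ^ 2 * ((m * n₀ : ℕ) : ℝ) ^ (-s) ≤
            ∑' n, ‖(qExpansion 1 ⇑f).coeff n‖ ^ 2 * (n : ℝ) ^ (-s) :=
          tsum_comp_le_tsum_of_inj hD (fun n ↦ by positivity) hinj
        exact mul_le_mul_of_nonneg_left h5 hK

end link

/-! ### Euler product over a finite set of good primes, and the local step -/

section euler

omit [NeZero N]

variable (c : ℕ → ℂ) (ε : DirichletCharacter ℂ N) (k : ℤ) (L : ℕ)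

/-- `∏_{p ∈ S} ∑_r g_s(p^r) ≤ ∑_m g_s(m)` for a finite set `S` of primes (Euler product over
`S`-factored numbers, non-negative terms). [folklore] -/
lemma prod_tsum_weight_le (S : Finset ℕ) (hS : ∀ p ∈ S, p.Prime) {s : ℝ}
    (hsum : Summable (weight c ε k L s)) :
    ∏ p ∈ S, ∑' r, weight c ε k L s (p ^ r) ≤ ∑' m, weight c ε k L s m := by
  have hnorm : Summable fun m ↦ ‖weight c ε k L s m‖ := by
    simpa only [Real.norm_of_nonneg (weight_nonneg c ε k L s _)] using hsum
  have h := EulerProduct.prod_filter_prime_tsum_eq_tsum_factoredNumbers (f := weight c ε k L s)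
    (weight_one c ε k L s) (fun hmn ↦ weight_mul_of_coprime c ε k L s hmn) hnorm S
  rw [Finset.filter_true_of_mem hS] at h
  rw [h]
  exact hsum.tsum_subtype_le (weight c ε k L s) _ (weight_nonneg c ε k L s)

/-- `|ε(p) p^{k-1}|² (p^{-s})² = p^{2(k-1-s)}` for `p ∤ N`. [folklore] -/
lemma norm_sq_heckeB (s : ℝ) {p : ℕ} (hp : p.Prime) (hpN : ¬ p ∣ N) [NeZero N] :
    ‖ε p * (p : ℂ) ^ (k - 1)‖ ^ 2 * ((p : ℝ) ^ (-s)) ^ 2 =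
      (p : ℝ) ^ (2 * ((k : ℝ) - 1 - s)) := by
  have hcop : Nat.Coprime p N := hp.coprime_iff_not_dvd.mpr hpN
  have hε : ‖ε p‖ = 1 := by
    rw [← ZMod.coe_unitOfCoprime p hcop]
    exact ε.unit_norm_eq_one (ZMod.unitOfCoprime p hcop)
  have hp0 : (0 : ℝ) < p := by exact_mod_cast hp.pos
  rw [norm_mul, hε, one_mul, norm_zpow, Complex.norm_natCast, ← Real.rpow_intCast,
    ← Real.rpow_natCast _ 2, ← Real.rpow_natCast _ 2, ← Real.rpow_mul hp0.le,
    ← Real.rpow_mul hp0.le, ← Real.rpow_add hp0]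
  congr 1
  push_cast
  ring

/-- **The local step** (one Euler factor, Deligne–Serre §5.2): for a prime `p ∤ L`, `p ∤ N` and
`k < s' < s` with `g_s, g_{s'}` summable,
`|c_p|² p^{-s} + log (1 - p^{2(k-1-s)}) ≤ log ∑_r g_s(p^r)`. [cite: DeligneSerreASENS1974, §5.2] -/
lemma local_step [NeZero N] {p : ℕ} (hp : p.Prime) (hpL : ¬ p ∣ L) (hpN : ¬ p ∣ N) {s s' : ℝ}
    (hss' : s' < s) (hsum : Summable (weight c ε k L s)) (hsum' : Summable (weight c ε k L s')) :
    ‖c p‖ ^ 2 * (p : ℝ) ^ (-s) + Real.log (1 - (p : ℝ) ^ (2 * ((k : ℝ) - 1 - s))) ≤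
      Real.log (∑' r, weight c ε k L s (p ^ r)) := by
  have hp1 : (1 : ℝ) < p := by exact_mod_cast hp.one_lt
  have hT : 0 < (p : ℝ) ^ (-s) := Real.rpow_pos_of_pos (by positivity) _
  have hTT' : (p : ℝ) ^ (-s) < (p : ℝ) ^ (-s') := Real.rpow_lt_rpow_of_exponent_lt hp1 (by linarith)
  have hinj : Function.Injective fun r : ℕ ↦ p ^ r := Nat.pow_right_injective hp.two_le
  have hS : Summable fun r ↦ ‖heckeSeq c ε k p r‖ ^ 2 * ((p : ℝ) ^ (-s)) ^ r := by
    have h := hsum.comp_injective hinj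
    refine h.congr fun r ↦ ?_
    exact weight_prime_pow c ε k L s hp hpL r
  have hS' : Summable fun r ↦ ‖heckeSeq c ε k p r‖ ^ 2 * ((p : ℝ) ^ (-s')) ^ r := by
    have h := hsum'.comp_injective hinj
    refine h.congr fun r ↦ ?_
    exact weight_prime_pow c ε k L s' hp hpL r
  obtain ⟨-, hle⟩ := local_estimate (a := c p) (b := ε p * (p : ℂ) ^ (k - 1)) hT hTT' hS hS'
  rw [norm_sq_heckeB ε k s hp hpN] at hle
  convert hle using 2
  exact tsum_congr fun r ↦ weight_prime_pow c ε k L s hp hpL r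

end euler

/-! ### Summation over the good primes and the numerical constants -/

section good

omit [NeZero N]

variable (c : ℕ → ℂ) (ε : DirichletCharacter ℂ N) (k : ℤ) (L : ℕ)

/-- `-(4/3) p^{-2} ≤ log (1 - p^{2(k-1-s)})` for `p ≥ 2`, `s > k`. [folklore] -/
lemma log_one_sub_ge {p : ℕ} (hp : p.Prime) {s : ℝ} (hks : (k : ℝ) < s) :
    -(4 / 3 * ((p : ℝ) ^ 2)⁻¹) ≤ Real.log (1 - (p : ℝ) ^ (2 * ((k : ℝ) - 1 - s))) := by
  set y : ℝ := (p : ℝ) ^ (2 * ((k : ℝ) - 1 - s)) with hy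
  have hy0 : 0 ≤ y := Real.rpow_nonneg (Nat.cast_nonneg p) _
  have hyp : y ≤ ((p : ℝ) ^ 2)⁻¹ := by
    rw [hy, ← Real.rpow_natCast _ 2, ← Real.rpow_neg (Nat.cast_nonneg p)]
    exact Real.rpow_le_rpow_of_exponent_le (by exact_mod_cast hp.one_lt.le) (by push_cast; linarith)
  have hp4 : ((p : ℝ) ^ 2)⁻¹ ≤ 1 / 4 := by
    rw [one_div]
    apply inv_anti₀ (by norm_num)
    have : (2 : ℝ) ≤ p := by exact_mod_cast hp.two_le
    nlinarith
  have hy4 : y ≤ 1 / 4 := hyp.trans hp4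
  have h1y : 0 < 1 - y := by linarith
  have h1 := Real.log_le_sub_one_of_pos (inv_pos.mpr h1y)
  rw [Real.log_inv] at h1
  have h2 : (1 - y)⁻¹ - 1 ≤ 4 / 3 * y := by
    rw [inv_eq_one_div, div_sub_one h1y.ne', show (1 - (1 - y)) = y by ring, div_le_iff₀ h1y]
    nlinarith
  nlinarith

/-- **Sum over good primes** (Deligne–Serre §5.2, `g₁(s) ≤ g(s) = log L(s)` made effective): for a
finite set `S` of primes `p ∤ L`, `p ∤ N` and `k < s' < s` with `g_s, g_{s'}` summable,
`∑_{p ∈ S} |c_p|² p^{-s} ≤ log (∑_m g_s(m)) + (4/3) ∑_n n^{-2}`. [cite: DeligneSerreASENS1974, §5.2] -/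
lemma sum_good_le [NeZero N] (S : Finset ℕ) (hS : ∀ p ∈ S, p.Prime ∧ ¬ p ∣ L ∧ ¬ p ∣ N)
    {s s' : ℝ} (hks : (k : ℝ) < s) (hss' : s' < s) (hsum : Summable (weight c ε k L s))
    (hsum' : Summable (weight c ε k L s')) :
    ∑ p ∈ S, ‖c p‖ ^ 2 * (p : ℝ) ^ (-s) ≤
      Real.log (∑' m, weight c ε k L s m) + 4 / 3 * ∑' n : ℕ, ((n : ℝ) ^ 2)⁻¹ := by
  have hW1 : ∀ p ∈ S, 1 ≤ ∑' r, weight c ε k L s (p ^ r) := fun p hp ↦ by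
    have h := (hsum.comp_injective (Nat.pow_right_injective (hS p hp).1.two_le)).le_tsum 0
      (fun r _ ↦ weight_nonneg c ε k L s _)
    simpa [weight_one] using h
  have hlocal : ∀ p ∈ S, ‖c p‖ ^ 2 * (p : ℝ) ^ (-s) ≤
      Real.log (∑' r, weight c ε k L s (p ^ r)) + 4 / 3 * ((p : ℝ) ^ 2)⁻¹ := by
    intro p hp
    obtain ⟨hpp, hpL, hpN⟩ := hS p hp
    have h := local_step c ε k L hpp hpL hpN hss' hsum hsum'
    have hlog := log_one_sub_ge k hpp hks
    linarith
  have hζ : Summable fun n : ℕ ↦ ((n : ℝ) ^ 2)⁻¹ := Real.summable_nat_pow_inv.mpr one_lt_two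
  calc ∑ p ∈ S, ‖c p‖ ^ 2 * (p : ℝ) ^ (-s)
      ≤ ∑ p ∈ S, (Real.log (∑' r, weight c ε k L s (p ^ r)) + 4 / 3 * ((p : ℝ) ^ 2)⁻¹) :=
        Finset.sum_le_sum hlocal
    _ = Real.log (∏ p ∈ S, ∑' r, weight c ε k L s (p ^ r)) + 4 / 3 * ∑ p ∈ S, ((p : ℝ) ^ 2)⁻¹ := by
        rw [Finset.sum_add_distrib, Real.log_prod (fun p hp ↦ by linarith [hW1 p hp]),
          Finset.mul_sum]
    _ ≤ Real.log (∑' m, weight c ε k L s m) + 4 / 3 * ∑' n : ℕ, ((n : ℝ) ^ 2)⁻¹ := by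
        refine add_le_add (Real.log_le_log (Finset.prod_pos fun p hp ↦ by linarith [hW1 p hp])
            (prod_tsum_weight_le c ε k L S (fun p hp ↦ (hS p hp).1) hsum)) ?_
        exact mul_le_mul_of_nonneg_left (hζ.sum_le_tsum S (fun n _ ↦ by positivity))
          (by norm_num)

end good

omit [NeZero N] in
/-- `(1 - 2^{-u})^{-1} ≤ 4/u` for `0 < u ≤ 1` (from `1 - e^{-v} ≥ v e^{-v}` and `log 2 > 1/2`).
[folklore] -/
lemma inv_one_sub_two_rpow_le {u : ℝ} (hu0 : 0 < u) (hu1 : u ≤ 1) :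
    (1 - (2 : ℝ) ^ (-u))⁻¹ ≤ 4 / u := by
  have hlog2 : (1 : ℝ) / 2 < Real.log 2 := by
    have := Real.log_two_gt_d9
    linarith
  set v : ℝ := u * Real.log 2 with hv
  have hv0 : 0 < v := by positivity
  have hexp : (2 : ℝ) ^ (-u) = Real.exp (-v) := by
    rw [Real.rpow_def_of_pos two_pos, hv]
    ring_nf
  have h1 : v * Real.exp (-v) ≤ 1 - Real.exp (-v) := by
    have h := Real.add_one_le_exp v
    have hpos := Real.exp_pos (-v)
    have hmul : Real.exp v * Real.exp (-v) = 1 := by rw [← Real.exp_add]; simp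
    nlinarith
  have h2 : (1 : ℝ) / 2 ≤ Real.exp (-v) := by
    have h3 : Real.exp (-Real.log 2) = 1 / 2 := by
      rw [Real.exp_neg, Real.exp_log two_pos, one_div]
    rw [← h3]
    apply Real.exp_le_exp.mpr
    have : v ≤ Real.log 2 := by
      rw [hv]
      nlinarith [Real.log_two_gt_d9]
    linarith
  have h3 : u / 4 ≤ 1 - (2 : ℝ) ^ (-u) := by
    rw [hexp]
    have : u / 4 ≤ v * Real.exp (-v) := by
      rw [hv]
      nlinarith [Real.exp_pos (-v), hlog2]
    linarith
  calc (1 - (2 : ℝ) ^ (-u))⁻¹ ≤ (u / 4)⁻¹ := inv_anti₀ (by positivity) h3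
    _ = 4 / u := inv_div u 4
end Literature.NumberTheory.EllipticCurves.ModularForms.DeligneSerre1974.Prop51

/-! ## The discharge -/

namespace Literature.NumberTheory.EllipticCurves.ModularForms.DeligneSerre1974

open Prop51

/-- **Deligne–Serre 1974, Prop. 5.1 — discharged.** For a non-zero cusp form `f` of type `(k, ε)` on
`Γ₀(N)` (i.e. `f ∈ S_k(N, ε) ⊆ S_k(Γ₁(N))`) which is an eigenfunction of the `T_p`, `p ∤ N`, with
eigenvalues `a_p`, the series `∑_{p ∤ N} |a_p|² p^{-s}` converges for real `s > k` and
`∑_{p ∤ N} |a_p|² p^{-s} ≤ log (1/(s-k)) + O(1)` as `s → k⁺`.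

The printed proof deduces this from Rankin's theorem (meromorphic continuation of
`∑ |a_n|² n^{-s}` with a simple pole at `s = k`) through the four-factor Euler product `L(s)` and
Landau's lemma. The proof given here follows the same architecture (reduction to the
coefficients of `f` prime to an auxiliary `n₀ N` instead of to a newform; the four-factor Euler
product and the positivity `g₁ ≤ g = log L`), but replaces Rankin's continuation by the elementary
majorant `∑_n |a_n|² n^{-s} = O(1/(s-k))`, obtained from Parseval's formula on horizontal lines
and the bound `|f(τ)| ≪ (im τ)^{-k/2}`; this suffices for the *inequality* (5.1.1).
[cite: DeligneSerreASENS1974, Prop. 5.1] -/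
theorem prop51_holds : prop51 := by
  intro N _ k ε f hf hne heig
  have hk : 0 ≤ k := by
    by_contra h
    exact hne (eq_zero_of_weight_neg (by omega) f)
  have hk' : (0 : ℝ) ≤ k := by exact_mod_cast hk
  set c : ℕ → ℂ := fun p ↦ heckeEigenvalue f p with hc
  have heig' : ∀ p : ℕ, (hp : p.Prime) → ¬ p ∣ N →
      (haveI : NeZero p := ⟨hp.ne_zero⟩; heckeT (Gamma1 N) k p f) = c p • f := by
    intro p hp hpN
    haveI : NeZero p := ⟨hp.ne_zero⟩
    exact heckeT_eq_heckeEigenvalue_smul f p (heig p hp hpN)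
  obtain ⟨n₀, hn0, hn₀⟩ := exists_coeff_ne_zero hne
  obtain ⟨C₂, hC₂, hA2⟩ := sum_sq_coeff_rpow_le f
  set L : ℕ := n₀ * N with hL
  have hDs : ∀ s : ℝ, (k : ℝ) < s →
      Summable (fun n ↦ ‖(qExpansion 1 ⇑f).coeff n‖ ^ 2 * (n : ℝ) ^ (-s)) ∧
        ∑' n, ‖(qExpansion 1 ⇑f).coeff n‖ ^ 2 * (n : ℝ) ^ (-s) ≤
          C₂ * (2 : ℝ) ^ s / (1 - (2 : ℝ) ^ ((k : ℝ) - s)) :=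
    fun s hs ↦ summable_sq_coeff_rpow f hA2 (by linarith) hs
  have hWs : ∀ s : ℝ, (k : ℝ) < s → Summable (weight c ε k L s) ∧
      ∑' m, weight c ε k L s m ≤ ((n₀ : ℝ) ^ s / ‖(qExpansion 1 ⇑f).coeff n₀‖ ^ 2) *
        ∑' n, ‖(qExpansion 1 ⇑f).coeff n‖ ^ 2 * (n : ℝ) ^ (-s) :=
    fun s hs ↦ summable_weight ε f hf c heig' hn₀ (hDs s hs).1
  -- the bad primes `p ∣ n₀`
  set Cbad : ℝ := ∑ p ∈ n₀.primeFactors, ‖c p‖ ^ 2 with hCbad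
  have hsplit : ∀ s : ℝ, 0 ≤ s → ∀ F : Finset ℕ,
      ∑ p ∈ F, rankinTerm f s p ≤
        (∑ p ∈ F with (p.Prime ∧ ¬ p ∣ L ∧ ¬ p ∣ N), ‖c p‖ ^ 2 * (p : ℝ) ^ (-s)) + Cbad := by
    intro s hs F
    have hpt : ∀ p ∈ F, rankinTerm f s p ≤
        (if p.Prime ∧ ¬ p ∣ L ∧ ¬ p ∣ N then ‖c p‖ ^ 2 * (p : ℝ) ^ (-s) else 0) +
          (if p ∈ n₀.primeFactors then ‖c p‖ ^ 2 else 0) := by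
      intro p _
      unfold rankinTerm
      by_cases h : p.Prime ∧ ¬ p ∣ N
      · obtain ⟨hp, hpN⟩ := h
        rw [if_pos ⟨hp, hpN⟩]
        by_cases hpn : p ∣ n₀
        · have hmem : p ∈ n₀.primeFactors := Nat.mem_primeFactors.mpr ⟨hp, hpn, hn0⟩
          have hpL : ¬ (p.Prime ∧ ¬ p ∣ L ∧ ¬ p ∣ N) := fun h ↦ h.2.1 (Dvd.dvd.mul_right hpn N)
          rw [if_neg hpL, if_pos hmem, zero_add]
          have h1 : (p : ℝ) ^ (-s) ≤ 1 :=
            Real.rpow_le_one_of_one_le_of_nonpos (by exact_mod_cast hp.one_lt.le) (by linarith)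
          calc ‖heckeEigenvalue f p‖ ^ 2 * (p : ℝ) ^ (-s) ≤ ‖heckeEigenvalue f p‖ ^ 2 * 1 := by
                gcongr
            _ = ‖c p‖ ^ 2 := by rw [mul_one]
        · have hpL : ¬ p ∣ L := fun h ↦ (hp.dvd_mul.mp h).elim hpn hpN
          rw [if_pos ⟨hp, hpL, hpN⟩]
          have h0 : 0 ≤ (if p ∈ n₀.primeFactors then ‖c p‖ ^ 2 else 0) := by
            split_ifs <;> positivity
          linarith
      · rw [if_neg h, if_neg (fun h' ↦ h ⟨h'.1, h'.2.2⟩)]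
        split_ifs <;> positivity
    calc ∑ p ∈ F, rankinTerm f s p
        ≤ ∑ p ∈ F, ((if p.Prime ∧ ¬ p ∣ L ∧ ¬ p ∣ N then ‖c p‖ ^ 2 * (p : ℝ) ^ (-s) else 0) +
            (if p ∈ n₀.primeFactors then ‖c p‖ ^ 2 else 0)) := Finset.sum_le_sum hpt
      _ = (∑ p ∈ F with (p.Prime ∧ ¬ p ∣ L ∧ ¬ p ∣ N), ‖c p‖ ^ 2 * (p : ℝ) ^ (-s)) +
            ∑ p ∈ F with p ∈ n₀.primeFactors, ‖c p‖ ^ 2 := by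
          rw [Finset.sum_add_distrib, Finset.sum_filter, Finset.sum_filter]
      _ ≤ _ := by
          gcongr
          rw [hCbad]
          apply Finset.sum_le_sum_of_subset_of_nonneg
          · intro p hp
            exact (Finset.mem_filter.mp hp).2
          · intro p _ _
            positivity
  constructor
  · -- convergence for `s > k`
    intro s hs
    have hs0 : 0 ≤ s := by linarith
    refine summable_of_sum_le (rankinTerm_nonneg f s) (c := ∑' m, weight c ε k L s m + Cbad)
      fun F ↦ (hsplit s hs0 F).trans ?_
    gcongr
    calc ∑ p ∈ F with (p.Prime ∧ ¬ p ∣ L ∧ ¬ p ∣ N), ‖c p‖ ^ 2 * (p : ℝ) ^ (-s)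
        = ∑ p ∈ F with (p.Prime ∧ ¬ p ∣ L ∧ ¬ p ∣ N), weight c ε k L s p := by
          refine Finset.sum_congr rfl fun p hp ↦ ?_
          obtain ⟨hpp, hpL, -⟩ := (Finset.mem_filter.mp hp).2
          rw [weight_prime c ε k L s hpp hpL]
      _ ≤ ∑' m, weight c ε k L s m :=
          (hWs s hs).1.sum_le_tsum _ (fun m _ ↦ weight_nonneg c ε k L s m)
  · -- the estimate (5.1.1)
    set A : ℝ := (n₀ : ℝ) ^ ((k : ℝ) + 1) / ‖(qExpansion 1 ⇑f).coeff n₀‖ ^ 2 *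
      (C₂ * (2 : ℝ) ^ ((k : ℝ) + 1) * 4) with hA
    have hb0 : 0 < ‖(qExpansion 1 ⇑f).coeff n₀‖ := norm_pos_iff.mpr hn₀
    have hn1 : (1 : ℝ) ≤ n₀ := by exact_mod_cast Nat.one_le_iff_ne_zero.mpr hn0
    have hA0 : 0 < A := by positivity
    refine ⟨Real.log A + 4 / 3 * (∑' n : ℕ, ((n : ℝ) ^ 2)⁻¹) + Cbad, ?_⟩
    filter_upwards [Ioc_mem_nhdsGT (show (k : ℝ) < k + 1 by linarith)] with s hs
    obtain ⟨hks, hsk1⟩ := hs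
    have hs0 : 0 ≤ s := by linarith
    have hu0 : 0 < s - k := by linarith
    obtain ⟨hsumW, hWle⟩ := hWs s hks
    have hsumW' := (hWs ((s + k) / 2) (by linarith)).1
    -- `∑ g_s ≤ A / (s - k)`
    have hWbound : ∑' m, weight c ε k L s m ≤ A / (s - k) := by
      have hD := (hDs s hks).2
      have hK0 : 0 ≤ (n₀ : ℝ) ^ s / ‖(qExpansion 1 ⇑f).coeff n₀‖ ^ 2 := by positivity
      have h12 : 0 < 1 - (2 : ℝ) ^ ((k : ℝ) - s) := by
        have : (2 : ℝ) ^ ((k : ℝ) - s) < 1 :=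
          Real.rpow_lt_one_of_one_lt_of_neg one_lt_two (by linarith)
        linarith
      have hgeom : (1 - (2 : ℝ) ^ ((k : ℝ) - s))⁻¹ ≤ 4 / (s - k) := by
        have h := inv_one_sub_two_rpow_le hu0 (by linarith)
        rwa [show -(s - (k : ℝ)) = (k : ℝ) - s by ring] at h
      calc ∑' m, weight c ε k L s m
          ≤ ((n₀ : ℝ) ^ s / ‖(qExpansion 1 ⇑f).coeff n₀‖ ^ 2) *
              (C₂ * (2 : ℝ) ^ s / (1 - (2 : ℝ) ^ ((k : ℝ) - s))) :=
            hWle.trans (mul_le_mul_of_nonneg_left hD hK0)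
        _ = ((n₀ : ℝ) ^ s / ‖(qExpansion 1 ⇑f).coeff n₀‖ ^ 2) *
              (C₂ * (2 : ℝ) ^ s * (1 - (2 : ℝ) ^ ((k : ℝ) - s))⁻¹) := by
            rw [div_eq_mul_inv (C₂ * (2 : ℝ) ^ s)]
        _ ≤ ((n₀ : ℝ) ^ ((k : ℝ) + 1) / ‖(qExpansion 1 ⇑f).coeff n₀‖ ^ 2) *
              (C₂ * (2 : ℝ) ^ ((k : ℝ) + 1) * (4 / (s - k))) := by
            gcongr
            exact one_le_two
        _ = A / (s - k) := by
            rw [hA]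
            field_simp
    have hWpos : 0 < ∑' m, weight c ε k L s m := by
      have h := hsumW.le_tsum 1 (fun m _ ↦ weight_nonneg c ε k L s m)
      rw [weight_one] at h
      linarith
    have hlogW : Real.log (∑' m, weight c ε k L s m) ≤ Real.log A + Real.log (1 / (s - k)) := by
      have h := Real.log_le_log hWpos hWbound
      rw [one_div, Real.log_inv, ← sub_eq_add_neg, ← Real.log_div hA0.ne' hu0.ne']
      exact h
    refine Real.tsum_le_of_sum_le (rankinTerm_nonneg f s) fun F ↦ (hsplit s hs0 F).trans ?_
    have hgood := sum_good_le c ε k L (F.filter fun p ↦ p.Prime ∧ ¬ p ∣ L ∧ ¬ p ∣ N)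
      (fun p hp ↦ (Finset.mem_filter.mp hp).2) hks (show (s + k) / 2 < s by linarith) hsumW hsumW'
    linarith

end Literature.NumberTheory.EllipticCurves.ModularForms.DeligneSerre1974
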